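import Mathlib.NumberTheory.Chebyshev
import Mathlib.Analysis.SpecialFunctions.Pow.Asymptotics
import Mathlib.Analysis.Complex.ExponentialBounds
import Literature.NumberTheory.Sieve.LevelOfDistribution
import Literature.NumberTheory.Sieve.PrimePowersInProgressions
import Literature.NumberTheory.LFunctions.PrimeNumberTheoremErrorTerm
import Literature.NumberTheory.LFunctions.ChebyshevPsiLogPowerError
import HarnessLib

/-!
# `ψ`- versus `π`-form of the level of distribution of the primes

Topic `Literature/NumberTheory/Sieve`, companion ("Proofs") file of `LevelOfDistribution.lean` for
the named fact `Literature.NumberTheory.Sieve.primesHaveLevel_iff_primesHaveLevelPi` (`∀ θ, PrimesHaveLevel θ ↔ PrimesHaveLevelPi θ`,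
[cite: IwaniecKowalski2004, §17.1]).  Main results: `primesHaveLevel_iff_primesHaveLevelPi_holds`,
the named fact PROVED, as `primesHaveLevel_iff_primesHaveLevelPi_of_isBigO` (the named fact from the
prime number theorem in the log-power form `ψ(x) = x + O_A(x/(log x)^A)` for every `A`) applied to
the tree's proof of that form of the prime number theorem
(`Literature.NumberTheory.LFunctions.PsiLogPower.chebyshevPsi_sub_self_isBigO_div_logPow`,
`Literature/NumberTheory/LFunctions/ChebyshevPsiLogPowerError.lean`);
`primesHaveLevel_iff_primesHaveLevelPi_of`, the same from the named fact
`ChebyshevPsiDeLaValleePoussin` (de la Vallée Poussin's error term,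
`Literature/NumberTheory/LFunctions/PrimeNumberTheoremErrorTerm.lean`) through its log-power
weakening; and `PrimesHaveLevel.isBigO_chebyshevPsi_sub_self`, showing that this log-power form of
the prime number theorem is in turn implied by the `ψ`-form of level `x^θ` for any `θ > 0`, so that
an input of this (log-power) strength is necessary.

## The argument

Write `E_ψ(x; q) = max_{1 ≤ y ≤ x} max_{(a,q)=1} |ψ(y; q, a) − y/φ(q)|` (`primeAPError`),
`E_π(x; q) = max_{1 ≤ y ≤ x} max_{(a,q)=1} |π(y; q, a) − π(y)/φ(q)|` (the summand of
`PrimesHaveLevelPi`) and `R_{q,a}(N) = ∑_{n ≤ N, n non-prime, n ≡ a (q)} Λ(n)` (`chebyshevPsiModNotPrime`,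
the prime-power part of `ψ(N; q, a)`).  By discrete partial summation (Abel) and Chebyshev's
`ψ(x) − ϑ(x) ≤ 2 √x log x` (Mathlib `Chebyshev.psi_sub_theta_le`) one has, for `1 ≤ q` and `x ≥ 1`,

* `E_π(x; q) ≤ (E_ψ(x; q) + (E_ψ(x; 1) + 2 √x log x)/φ(q) + max_a R_{q,a}(⌊x⌋)) / log 2`
  (`iSup_primeCountingDisc_le`), and
* `E_ψ(x; q) ≤ 2 log x · E_π(x; q) + (F(x) + 2 √x log x + 1)/φ(q) + max_a R_{q,a}(⌊x⌋)`, where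
  `F(x) = max_{n ≤ x} |ψ(n) − n|` (`primeAPError_le_of_primeCountingDisc`).

Summing over `q ≤ Q = x^{θ−ε}` with `∑_{q ≤ Q} 1/φ(q) ≤ (1 + log Q)²` (private, harmonic sums) and the
averaged prime-power bound `∑_{q ≤ Q} max_a R_{q,a}(⌊x⌋) ≪_{ε,A} x/(log x)^A` for `Q ≤ x^{1−ε}`
(`eventually_sum_iSup_nonPrime_vonMangoldt_residue_le` of `PrimePowersInProgressions.lean`) gives —
this is the remark "proving (9.27) is equivalent to proving [the `ψ`-form]" in the proof of
Cojocaru–Murty, *An Introduction to Sieve Methods and their Applications*, Thm 9.2.1 (PDF p. 99),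
and of Iwaniec–Kowalski §17.1 —

1. `PrimesHaveLevel.primesHaveLevelPi`: `PrimesHaveLevel θ → PrimesHaveLevelPi θ` for EVERY `θ`,
   PROVED unconditionally (the term `E_ψ(x; 1)` is part of the hypothesis; `θ ≤ 1` is forced by
   `PrimesHaveLevel.le_one`).  In particular `BombieriVinogradovStatement.primesHaveLevelPi` and
   `ElliottHalberstam.primesHaveLevelPi`.
2. `PrimesHaveLevelPi.primesHaveLevel_of_isBigO'`: `PrimesHaveLevelPi θ → PrimesHaveLevel θ` for
   every `θ`, PROVED from the prime number theorem with error term `ψ(x) = x + O_A(x/(log x)^A)`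
   for every `A`; `PrimesHaveLevelPi.primesHaveLevel` takes instead the named fact
   `ChebyshevPsiDeLaValleePoussin` (Montgomery–Vaughan, *Multiplicative Number Theory I*, Thm 6.9
   (6.12): `ψ(x) = x + O(x exp(−c √log x))`), via `ChebyshevPsiDeLaValleePoussin.isBigO_logPow`.
3. `PrimesHaveLevel.isBigO_chebyshevPsi_sub_self`: conversely `PrimesHaveLevel θ` for some `θ > 0`
   already contains `ψ(x) = x + O_A(x/(log x)^A)` (the `q = 1` term), so the input in (2) is
   NECESSARY: the direction `π → ψ` cannot be proved for any `θ > 0` without the prime number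
   theorem with this error term, which is not in Mathlib.
4. `not_primesHaveLevelPi_of_one_lt`: for `θ > 1` the `π`-form is false (the primes
   `q ∈ (4x, x^{(1+θ)/2}]`, of which there are `≫ x^{(1+θ)/2}/log x` by Chebyshev's bound
   `Chebyshev.pi_ge'`, each contribute `≥ 1/3` at the residue `a = 2`), as is the `ψ`-form
   (`PrimesHaveLevel.le_one`), so the equivalence holds there — PROVED unconditionally; the range
   `θ − ε < 0` is vacuous (`primesHaveLevel_iff_primesHaveLevelPi_of_nonpos`).
5. `primesHaveLevel_iff_primesHaveLevelPi_of_isBigO` / `primesHaveLevel_iff_primesHaveLevelPi_of`: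
   the assembly of the named fact for all `θ` from the prime number theorem with error term, resp.
   from `ChebyshevPsiDeLaValleePoussin`; and `primesHaveLevel_iff_primesHaveLevelPi_holds`, the
   former applied to `Literature.NumberTheory.LFunctions.PsiLogPower.chebyshevPsi_sub_self_isBigO_div_logPow` (proved in the tree
   from Titchmarsh's bounds (3.6.5)–(3.6.6) by a smoothed Perron formula and integration by parts).

## References

* [CojocaruMurty2005] A. C. Cojocaru, M. R. Murty, *An Introduction to Sieve Methods and their
  Applications*, LMS Student Texts 66, CUP (2005), §9.2, Thm 9.2.1 and its proof (PDF pp. 98–100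
  of the held copy; PDF p. 99: "proving (9.27) is equivalent to proving [the `ψ`-form]"; (9.31): the
  prime number theorem input).  NB: (9.27) is printed with the main term `li y/φ(d)` (PDF p. 98); the
  remark is applied here in the `π(y)/φ(q)` normalisation of `PrimesHaveLevelPi`, the two main terms
  differing by `|π(y) − li y|/φ(q)`.
* [IwaniecKowalski2004] H. Iwaniec, E. Kowalski, *Analytic Number Theory*, AMS Colloq. Publ. 53
  (2004), §17.1, Thm 17.1 (the cite carried by the named fact; not held locally at the time of
  writing, acquisition requested).
* [MontgomeryVaughan2007] H. L. Montgomery, R. C. Vaughan, *Multiplicative Number Theory I*,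
  Cambridge Studies in Advanced Mathematics 97, CUP (2007), §6.2, Thm 6.9, (6.12) (PDF p. 143).
-/

open Filter Asymptotics Finset Real
open scoped ArithmeticFunction.vonMangoldt

namespace Literature.NumberTheory.Sieve

/-! ### Discrete partial summation (Abel) with a uniform bound on the partial sums -/

/-- Abel summation with bounded partial sums: if `|∑_{k ≤ n} c_k| ≤ M` for all `n ≤ N`, then
`|∑_{k ≤ N} c_k f_k − (∑_{k ≤ N} c_k) f_N| ≤ M ∑_{k < N} |f_k − f_{k+1}|`. [folklore] -/
theorem abs_sum_mul_sub_le_of_abs_partialSum_le (c f : ℕ → ℝ) (M : ℝ) :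
    ∀ N : ℕ, (∀ n ≤ N, |∑ k ∈ range (n + 1), c k| ≤ M) →
      |∑ k ∈ range (N + 1), c k * f k - (∑ k ∈ range (N + 1), c k) * f N| ≤
        M * ∑ k ∈ range N, |f k - f (k + 1)| := by
  intro N
  induction N with
  | zero => intro _; simp
  | succ N ih =>
    intro hM
    have h1 := ih fun n hn => hM n (Nat.le_succ_of_le hn)
    have h2 : |∑ k ∈ range (N + 1), c k| ≤ M := hM N (Nat.le_succ N)
    have key : ∑ k ∈ range (N + 1 + 1), c k * f k - (∑ k ∈ range (N + 1 + 1), c k) * f (N + 1) =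
        (∑ k ∈ range (N + 1), c k * f k - (∑ k ∈ range (N + 1), c k) * f N) +
          (∑ k ∈ range (N + 1), c k) * (f N - f (N + 1)) := by
      rw [sum_range_succ (fun k => c k * f k), sum_range_succ c]; ring
    rw [key, sum_range_succ (fun k => |f k - f (k + 1)|), mul_add]
    refine (abs_add_le _ _).trans (add_le_add h1 ?_)
    rw [abs_mul]
    exact mul_le_mul_of_nonneg_right h2 (abs_nonneg _)

/-- Abel summation against a non-increasing nonnegative weight: if `|∑_{k ≤ n} c_k| ≤ M` for all
`n ≤ N` and `f_0 ≥ f_1 ≥ ⋯ ≥ 0`, then `|∑_{k ≤ N} c_k f_k| ≤ M f_0`. [folklore] -/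
theorem abs_sum_mul_le_of_antitone (c f : ℕ → ℝ) (M : ℝ) (N : ℕ)
    (hM : ∀ n ≤ N, |∑ k ∈ range (n + 1), c k| ≤ M) (hf : ∀ k, f (k + 1) ≤ f k)
    (hf0 : ∀ k, 0 ≤ f k) : |∑ k ∈ range (N + 1), c k * f k| ≤ M * f 0 := by
  have h := abs_sum_mul_sub_le_of_abs_partialSum_le c f M N hM
  have htel : ∑ k ∈ range N, |f k - f (k + 1)| = f 0 - f N := by
    rw [← sum_range_sub' f N]
    exact sum_congr rfl fun k _ => abs_of_nonneg (sub_nonneg.mpr (hf k))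
  rw [htel] at h
  have h2 : |(∑ k ∈ range (N + 1), c k) * f N| ≤ M * f N := by
    rw [abs_mul, abs_of_nonneg (hf0 N)]
    exact mul_le_mul_of_nonneg_right (hM N le_rfl) (hf0 N)
  have := abs_sub_abs_le_abs_sub (∑ k ∈ range (N + 1), c k * f k)
    ((∑ k ∈ range (N + 1), c k) * f N)
  nlinarith [this, h, h2]

/-- Abel summation against a non-decreasing nonnegative weight: if `|∑_{k ≤ n} c_k| ≤ M` for all
`n ≤ N` and `0 ≤ f_0 ≤ f_1 ≤ ⋯`, then `|∑_{k ≤ N} c_k f_k| ≤ 2 M f_N`. [folklore] -/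
theorem abs_sum_mul_le_of_monotone (c f : ℕ → ℝ) (M : ℝ) (N : ℕ)
    (hM : ∀ n ≤ N, |∑ k ∈ range (n + 1), c k| ≤ M) (hf : ∀ k, f k ≤ f (k + 1))
    (hf0 : ∀ k, 0 ≤ f k) : |∑ k ∈ range (N + 1), c k * f k| ≤ 2 * M * f N := by
  have h := abs_sum_mul_sub_le_of_abs_partialSum_le c f M N hM
  have htel : ∑ k ∈ range N, |f k - f (k + 1)| = f N - f 0 := by
    have := sum_range_sub' f N
    rw [show ∑ k ∈ range N, |f k - f (k + 1)| = -∑ k ∈ range N, (f k - f (k + 1)) by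
      rw [← sum_neg_distrib]
      exact sum_congr rfl fun k _ => by rw [abs_of_nonpos (sub_nonpos.mpr (hf k))], this]
    ring
  rw [htel] at h
  have hM0 : 0 ≤ M := (abs_nonneg _).trans (hM 0 (Nat.zero_le _))
  have h2 : |(∑ k ∈ range (N + 1), c k) * f N| ≤ M * f N := by
    rw [abs_mul, abs_of_nonneg (hf0 N)]
    exact mul_le_mul_of_nonneg_right (hM N le_rfl) (hf0 N)
  have := abs_sub_abs_le_abs_sub (∑ k ∈ range (N + 1), c k * f k)
    ((∑ k ∈ range (N + 1), c k) * f N)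
  nlinarith [this, h, h2, hf0 0]

/-! ### Residue-class prime sums and their discrepancies -/

/-- The indicator of the residue class `a (mod q)` on `ℕ`, real-valued. [folklore] -/
noncomputable def apIndicator (q : ℕ) (a : ZMod q) (n : ℕ) : ℝ :=
  if (n : ZMod q) = a then 1 else 0

/-- `π(N; q, a) − π(N)/φ(q)`, written as the sum over `n ≤ N` of
`1_{n prime} (1_{n ≡ a (q)} − 1/φ(q))`. [folklore] -/
noncomputable def primeCountingDisc (q : ℕ) (a : ZMod q) (N : ℕ) : ℝ :=
  ∑ n ∈ range (N + 1), if n.Prime then apIndicator q a n - 1 / Nat.totient q else 0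

/-- `ϑ(N; q, a) − ϑ(N)/φ(q)`, written as the sum over `n ≤ N` of
`1_{n prime} (1_{n ≡ a (q)} − 1/φ(q)) log n`. [folklore] -/
noncomputable def chebyshevThetaDisc (q : ℕ) (a : ZMod q) (N : ℕ) : ℝ :=
  ∑ n ∈ range (N + 1), (if n.Prime then apIndicator q a n - 1 / Nat.totient q else 0) * Real.log n

/-- `ψ(N; q, a) − N/φ(q)` at an integer `N` (`chebyshevPsiMod` minus its main term). [folklore] -/
noncomputable def chebyshevPsiDisc (q : ℕ) (a : ZMod q) (N : ℕ) : ℝ :=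
  LevelOfDistribution.chebyshevPsiMod q a N - N / Nat.totient q

/-- The prime-power part of `ψ(N; q, a)`: `∑_{n ≤ N, n not prime, n ≡ a (q)} Λ(n)`. [folklore] -/
noncomputable def chebyshevPsiModNotPrime (q : ℕ) (a : ZMod q) (N : ℕ) : ℝ :=
  ∑ n ∈ range (N + 1), if n.Prime then 0 else apIndicator q a n * Λ n

/-- `0 ≤ 1_{n ≡ a (q)}`. [folklore] -/
theorem apIndicator_nonneg (q : ℕ) (a : ZMod q) (n : ℕ) : 0 ≤ apIndicator q a n := by
  unfold apIndicator; split_ifs <;> norm_num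

/-- `1_{n ≡ a (q)} ≤ 1`. [folklore] -/
theorem apIndicator_le_one (q : ℕ) (a : ZMod q) (n : ℕ) : apIndicator q a n ≤ 1 := by
  unfold apIndicator; split_ifs <;> norm_num

/-- `ψ(N; q, a) = ∑_{n ≤ N} 1_{n ≡ a (q)} Λ(n)` (unfolding `chebyshevPsiMod` at an integer). [folklore] -/
theorem chebyshevPsiMod_natCast (q : ℕ) (a : ZMod q) (N : ℕ) :
    LevelOfDistribution.chebyshevPsiMod q a N = ∑ n ∈ range (N + 1), apIndicator q a n * Λ n := by
  rw [LevelOfDistribution.chebyshevPsiMod, Nat.floor_natCast]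
  refine sum_congr rfl fun n _ => ?_
  simp only [ArithmeticFunction.vonMangoldt.residueClass, Set.indicator_apply, Set.mem_setOf_eq,
    apIndicator]
  split_ifs <;> simp

/-- Chebyshev's `ψ` at an integer as a sum over `range (N + 1)`. [folklore] -/
theorem chebyshevPsi_natCast_eq_sum_range (N : ℕ) : Chebyshev.psi (N : ℝ) = ∑ n ∈ range (N + 1), Λ n := by
  rw [Chebyshev.psi_eq_sum_Icc, Nat.floor_natCast, ← Nat.range_succ_eq_Icc_zero]

/-- Chebyshev's `ϑ` at an integer as a sum over `range (N + 1)`. [folklore] -/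
theorem chebyshevTheta_natCast_eq_sum_range (N : ℕ) :
    Chebyshev.theta (N : ℝ) = ∑ n ∈ range (N + 1), if n.Prime then Real.log n else 0 := by
  rw [Chebyshev.theta_eq_sum_Icc, Nat.floor_natCast, ← Nat.range_succ_eq_Icc_zero, sum_filter]

/-- `0 ≤ ∑_{n ≤ N, n not prime, n ≡ a (q)} Λ(n)`. [folklore] -/
theorem chebyshevPsiModNotPrime_nonneg (q : ℕ) (a : ZMod q) (N : ℕ) :
    0 ≤ chebyshevPsiModNotPrime q a N := by
  refine sum_nonneg fun n _ => ?_
  split_ifs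
  · exact le_rfl
  · exact mul_nonneg (apIndicator_nonneg q a n) ArithmeticFunction.vonMangoldt_nonneg

/-- `∑_{n ≤ N, n not prime, n ≡ a (q)} Λ(n) ≤ ψ(N) − ϑ(N)`. [folklore] -/
theorem chebyshevPsiModNotPrime_le (q : ℕ) (a : ZMod q) (N : ℕ) :
    chebyshevPsiModNotPrime q a N ≤ Chebyshev.psi (N : ℝ) - Chebyshev.theta (N : ℝ) := by
  rw [chebyshevPsi_natCast_eq_sum_range, chebyshevTheta_natCast_eq_sum_range, ← sum_sub_distrib]
  refine sum_le_sum fun n _ => ?_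
  split_ifs with hp
  · rw [ArithmeticFunction.vonMangoldt_apply_prime hp, sub_self]
  · rw [sub_zero]
    exact mul_le_of_le_one_left ArithmeticFunction.vonMangoldt_nonneg (apIndicator_le_one q a n)

/-- The prime-power part of `ψ(N; q, a)` in the spelled-out form used in
`PrimePowersInProgressions.lean`. [folklore] -/
theorem chebyshevPsiModNotPrime_eq_sum_ite (q : ℕ) (a : ZMod q) (N : ℕ) :
    chebyshevPsiModNotPrime q a N =
      ∑ n ∈ range (N + 1), (if n.Prime then 0 else if (n : ZMod q) = a then Λ n else 0) := by
  refine sum_congr rfl fun n _ => ?_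
  by_cases hp : n.Prime
  · rw [if_pos hp, if_pos hp]
  · rw [if_neg hp, if_neg hp, apIndicator]
    split_ifs <;> simp

/-- The prime-power part of `ψ(N; q, a)` is non-decreasing in `N`. [folklore] -/
theorem chebyshevPsiModNotPrime_mono (q : ℕ) (a : ZMod q) {M N : ℕ} (h : M ≤ N) :
    chebyshevPsiModNotPrime q a M ≤ chebyshevPsiModNotPrime q a N := by
  refine sum_le_sum_of_subset_of_nonneg (range_subset_range.mpr (by omega)) fun n _ _ => ?_
  split_ifs
  · exact le_rfl
  · exact mul_nonneg (apIndicator_nonneg q a n) ArithmeticFunction.vonMangoldt_nonneg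

/-- `max_{(a,q)=1} R_{q,a}(N)`, the supremum over the (finitely many) units, dominates each term. [folklore] -/
theorem chebyshevPsiModNotPrime_le_iSup {q : ℕ} (a : (ZMod q)ˣ) (N : ℕ) :
    chebyshevPsiModNotPrime q a N ≤ ⨆ b : (ZMod q)ˣ, chebyshevPsiModNotPrime q b N :=
  le_ciSup (f := fun b : (ZMod q)ˣ => chebyshevPsiModNotPrime q b N) (Set.finite_range _).bddAbove a

/-- `0 ≤ max_{(a,q)=1} R_{q,a}(N)`. [folklore] -/
theorem iSup_chebyshevPsiModNotPrime_nonneg (q N : ℕ) :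
    0 ≤ ⨆ b : (ZMod q)ˣ, chebyshevPsiModNotPrime q b N :=
  Real.iSup_nonneg fun b => chebyshevPsiModNotPrime_nonneg q b N

/-- The basic identity linking the `ϑ`- and `ψ`-discrepancies:
`ϑ(N;q,a) − ϑ(N)/φ(q) = (ψ(N;q,a) − N/φ(q)) − (ψ(N) − N)/φ(q) − R_{q,a}(N) + (ψ(N) − ϑ(N))/φ(q)`,
where `R_{q,a}(N)` is the prime-power part of `ψ(N; q, a)`. [folklore] -/
theorem chebyshevThetaDisc_eq (q : ℕ) (a : ZMod q) (N : ℕ) :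
    chebyshevThetaDisc q a N = chebyshevPsiDisc q a N - (Chebyshev.psi (N : ℝ) - N) / Nat.totient q -
      chebyshevPsiModNotPrime q a N + (Chebyshev.psi (N : ℝ) - Chebyshev.theta (N : ℝ)) / Nat.totient q := by
  have h1 : chebyshevThetaDisc q a N =
      (∑ n ∈ range (N + 1), if n.Prime then apIndicator q a n * Real.log n else 0) -
        (∑ n ∈ range (N + 1), if n.Prime then Real.log n else 0) / Nat.totient q := by
    rw [chebyshevThetaDisc, sum_div, ← sum_sub_distrib]
    refine sum_congr rfl fun n _ => ?_
    split_ifs <;> ring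
  have h2 : LevelOfDistribution.chebyshevPsiMod q a N - chebyshevPsiModNotPrime q a N =
      ∑ n ∈ range (N + 1), if n.Prime then apIndicator q a n * Real.log n else 0 := by
    rw [chebyshevPsiMod_natCast, chebyshevPsiModNotPrime, ← sum_sub_distrib]
    refine sum_congr rfl fun n _ => ?_
    split_ifs with hp
    · rw [ArithmeticFunction.vonMangoldt_apply_prime hp, sub_zero]
    · rw [sub_self]
  rw [h1, ← h2, ← chebyshevTheta_natCast_eq_sum_range, chebyshevPsiDisc]
  ring

/-- `|ϑ(N;q,a) − ϑ(N)/φ(q)| ≤ |ψ(N;q,a) − N/φ(q)| + (|ψ(N) − N| + (ψ(N) − ϑ(N)))/φ(q) + R_{q,a}(N)`,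
where `R_{q,a}(N) = ∑_{n ≤ N, n non-prime, n ≡ a (q)} Λ(n)` is the prime-power part of `ψ(N; q, a)`.
[folklore] -/
theorem abs_chebyshevThetaDisc_le (q : ℕ) (a : ZMod q) (N : ℕ) :
    |chebyshevThetaDisc q a N| ≤
      |chebyshevPsiDisc q a N| +
        (|Chebyshev.psi (N : ℝ) - N| + (Chebyshev.psi (N : ℝ) - Chebyshev.theta (N : ℝ))) /
          Nat.totient q + chebyshevPsiModNotPrime q a N := by
  have hR0 := chebyshevPsiModNotPrime_nonneg q a N
  have hRR : 0 ≤ Chebyshev.psi (N : ℝ) - Chebyshev.theta (N : ℝ) :=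
    hR0.trans (chebyshevPsiModNotPrime_le q a N)
  have hφ0 : (0 : ℝ) ≤ Nat.totient q := Nat.cast_nonneg _
  have hZ : 0 ≤ (Chebyshev.psi (N : ℝ) - Chebyshev.theta (N : ℝ)) / Nat.totient q :=
    div_nonneg hRR hφ0
  have hY : |(Chebyshev.psi (N : ℝ) - N) / Nat.totient q| = |Chebyshev.psi (N : ℝ) - N| / Nat.totient q := by
    rw [abs_div, Nat.abs_cast]
  have hZR : |(Chebyshev.psi (N : ℝ) - Chebyshev.theta (N : ℝ)) / Nat.totient q -
      chebyshevPsiModNotPrime q a N| ≤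
      (Chebyshev.psi (N : ℝ) - Chebyshev.theta (N : ℝ)) / Nat.totient q + chebyshevPsiModNotPrime q a N := by
    rw [abs_le]; constructor <;> linarith
  rw [chebyshevThetaDisc_eq]
  calc |chebyshevPsiDisc q a N - (Chebyshev.psi (N : ℝ) - N) / Nat.totient q -
        chebyshevPsiModNotPrime q a N + (Chebyshev.psi (N : ℝ) - Chebyshev.theta (N : ℝ)) / Nat.totient q|
      = |chebyshevPsiDisc q a N + -((Chebyshev.psi (N : ℝ) - N) / Nat.totient q) +
          ((Chebyshev.psi (N : ℝ) - Chebyshev.theta (N : ℝ)) / Nat.totient q -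
            chebyshevPsiModNotPrime q a N)| := by ring_nf
    _ ≤ |chebyshevPsiDisc q a N| + |-((Chebyshev.psi (N : ℝ) - N) / Nat.totient q)| +
          |(Chebyshev.psi (N : ℝ) - Chebyshev.theta (N : ℝ)) / Nat.totient q -
            chebyshevPsiModNotPrime q a N| := abs_add_three _ _ _
    _ ≤ _ := by rw [abs_neg, hY, add_div]; linarith

/-- `|ψ(N;q,a) − N/φ(q)| ≤ |ϑ(N;q,a) − ϑ(N)/φ(q)| + (|ψ(N) − N| + (ψ(N) − ϑ(N)))/φ(q) + R_{q,a}(N)`.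
[folklore] -/
theorem abs_chebyshevPsiDisc_le (q : ℕ) (a : ZMod q) (N : ℕ) :
    |chebyshevPsiDisc q a N| ≤
      |chebyshevThetaDisc q a N| +
        (|Chebyshev.psi (N : ℝ) - N| + (Chebyshev.psi (N : ℝ) - Chebyshev.theta (N : ℝ))) /
          Nat.totient q + chebyshevPsiModNotPrime q a N := by
  have hR0 := chebyshevPsiModNotPrime_nonneg q a N
  have hRR : 0 ≤ Chebyshev.psi (N : ℝ) - Chebyshev.theta (N : ℝ) :=
    hR0.trans (chebyshevPsiModNotPrime_le q a N)
  have hφ0 : (0 : ℝ) ≤ Nat.totient q := Nat.cast_nonneg _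
  have hZ : 0 ≤ (Chebyshev.psi (N : ℝ) - Chebyshev.theta (N : ℝ)) / Nat.totient q :=
    div_nonneg hRR hφ0
  have hY : |(Chebyshev.psi (N : ℝ) - N) / Nat.totient q| = |Chebyshev.psi (N : ℝ) - N| / Nat.totient q := by
    rw [abs_div, Nat.abs_cast]
  have hRZ : |chebyshevPsiModNotPrime q a N -
      (Chebyshev.psi (N : ℝ) - Chebyshev.theta (N : ℝ)) / Nat.totient q| ≤
      (Chebyshev.psi (N : ℝ) - Chebyshev.theta (N : ℝ)) / Nat.totient q + chebyshevPsiModNotPrime q a N := by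
    rw [abs_le]; constructor <;> linarith
  have hid : chebyshevPsiDisc q a N = chebyshevThetaDisc q a N +
      (Chebyshev.psi (N : ℝ) - N) / Nat.totient q +
      (chebyshevPsiModNotPrime q a N -
        (Chebyshev.psi (N : ℝ) - Chebyshev.theta (N : ℝ)) / Nat.totient q) := by
    rw [chebyshevThetaDisc_eq]; ring
  rw [hid]
  refine (abs_add_three _ _ _).trans ?_
  rw [hY, add_div]
  linarith

/-! ### From `ϑ`-discrepancies to `π`-discrepancies and back (partial summation) -/

/-- `chebyshevThetaDisc q a 0 = 0`. [folklore] -/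
@[simp] theorem chebyshevThetaDisc_zero (q : ℕ) (a : ZMod q) : chebyshevThetaDisc q a 0 = 0 := by
  simp [chebyshevThetaDisc, Nat.not_prime_zero]

/-- `primeCountingDisc q a 0 = 0`. [folklore] -/
@[simp] theorem primeCountingDisc_zero (q : ℕ) (a : ZMod q) : primeCountingDisc q a 0 = 0 := by
  simp [primeCountingDisc, Nat.not_prime_zero]

/-- Partial summation, `ϑ → π`: if `|ϑ(n;q,a) − ϑ(n)/φ(q)| ≤ M` for all `n ≤ N` then
`|π(N;q,a) − π(N)/φ(q)| ≤ M / log 2`. [folklore] -/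
theorem abs_primeCountingDisc_le {q : ℕ} {a : ZMod q} {N : ℕ} {M : ℝ}
    (hM : ∀ n ≤ N, |chebyshevThetaDisc q a n| ≤ M) : |primeCountingDisc q a N| ≤ M / Real.log 2 := by
  set f : ℕ → ℝ := fun n => (Real.log (max 2 (n : ℝ)))⁻¹ with hf
  have hlog2 : 0 < Real.log 2 := Real.log_pos one_lt_two
  have hkey : primeCountingDisc q a N = ∑ n ∈ range (N + 1),
      ((if n.Prime then apIndicator q a n - 1 / Nat.totient q else 0) * Real.log n) * f n := by
    refine sum_congr rfl fun n _ => ?_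
    split_ifs with hp
    · have h2 : (2 : ℝ) ≤ n := by exact_mod_cast hp.two_le
      have hlogn : Real.log n ≠ 0 := (Real.log_pos (by linarith)).ne'
      simp only [hf, max_eq_right h2]
      field_simp
    · simp
  rw [hkey]
  have := abs_sum_mul_le_of_antitone
    (fun n => (if n.Prime then apIndicator q a n - 1 / Nat.totient q else 0) * Real.log n) f M N
    (fun n hn => hM n hn) ?_ ?_
  · simpa [hf, div_eq_mul_inv] using this
  · intro k
    simp only [hf]
    have h1 : (1 : ℝ) < max 2 (k : ℝ) := lt_of_lt_of_le one_lt_two (le_max_left _ _)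
    refine inv_anti₀ (Real.log_pos h1) (Real.log_le_log (by linarith) ?_)
    push_cast
    exact max_le_max le_rfl (by linarith)
  · intro k
    simp only [hf]
    exact inv_nonneg.mpr (Real.log_nonneg (le_trans one_le_two (le_max_left _ _)))

/-- Partial summation, `π → ϑ`: if `|π(n;q,a) − π(n)/φ(q)| ≤ M` for all `n ≤ N` then
`|ϑ(N;q,a) − ϑ(N)/φ(q)| ≤ 2 M log N`. [folklore] -/
theorem abs_chebyshevThetaDisc_le_of_primeCountingDisc {q : ℕ} {a : ZMod q} {N : ℕ} {M : ℝ}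
    (hM : ∀ n ≤ N, |primeCountingDisc q a n| ≤ M) :
    |chebyshevThetaDisc q a N| ≤ 2 * M * Real.log N := by
  have := abs_sum_mul_le_of_monotone
    (fun n => (if n.Prime then apIndicator q a n - 1 / Nat.totient q else 0))
    (fun n => Real.log (n : ℝ)) M N (fun n hn => hM n hn) ?_ ?_
  · exact this
  · intro k
    rcases Nat.eq_zero_or_pos k with rfl | hk
    · simp
    · exact Real.log_le_log (by exact_mod_cast hk) (by push_cast; linarith)
  · intro k
    exact Real.log_natCast_nonneg k

/-! ### Plumbing the suprema in `primeAPError` and in `PrimesHaveLevelPi` -/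

/-- For `1 ≤ n ≤ x` and `q ≠ 0`, `|ψ(n; q, a) − n/φ(q)| ≤ E_ψ(x; q)`. [folklore] -/
theorem abs_chebyshevPsiDisc_le_primeAPError {q : ℕ} (hq : q ≠ 0) (a : (ZMod q)ˣ) {x : ℝ} {n : ℕ}
    (hn1 : 1 ≤ n) (hnx : (n : ℝ) ≤ x) : |chebyshevPsiDisc q a n| ≤ primeAPError x q := by
  haveI : NeZero q := ⟨hq⟩
  have h1 : (1 : ℝ) ≤ n := by exact_mod_cast hn1
  refine le_ciSup_of_le (bddAbove_range_primeAPError x q hq) ⟨n, h1, hnx⟩ ?_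
  exact le_ciSup (f := fun a : (ZMod q)ˣ => |LevelOfDistribution.chebyshevPsiMod q a ((n : ℝ)) - (n : ℝ) / Nat.totient q|)
    (Set.finite_range _).bddAbove a

/-- `ψ(n; 1, ·) = ψ(n)`. [folklore] -/
theorem LevelOfDistributionProofs.chebyshevPsiMod_one (a : ZMod 1) (N : ℕ) : LevelOfDistribution.chebyshevPsiMod 1 a N = Chebyshev.psi (N : ℝ) := by
  rw [chebyshevPsiMod_natCast, chebyshevPsi_natCast_eq_sum_range]
  refine sum_congr rfl fun n _ => ?_
  rw [apIndicator, if_pos (Subsingleton.elim _ _), one_mul]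

/-- For `1 ≤ n ≤ x`, `|ψ(n) − n| ≤ E_ψ(x; 1)`. [folklore] -/
theorem abs_psi_sub_le_primeAPError_one {x : ℝ} {n : ℕ} (hn1 : 1 ≤ n) (hnx : (n : ℝ) ≤ x) :
    |Chebyshev.psi (n : ℝ) - n| ≤ primeAPError x 1 := by
  have h := abs_chebyshevPsiDisc_le_primeAPError one_ne_zero (1 : (ZMod 1)ˣ) hn1 hnx
  rwa [chebyshevPsiDisc, Units.val_one, LevelOfDistributionProofs.chebyshevPsiMod_one, Nat.totient_one, Nat.cast_one,
    div_one] at h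

/-- The uniform bound on the `ϑ`-discrepancies in terms of `E_ψ`: for `q ≠ 0`, `1 ≤ x` and
`n ≤ x`,
`|ϑ(n;q,a) − ϑ(n)/φ(q)| ≤ E_ψ(x;q) + (E_ψ(x;1) + 2 √x log x)/φ(q) + max_{(b,q)=1} R_{q,b}(⌊x⌋)`
(Chebyshev's `ψ(n) − ϑ(n) ≤ 2 √n log n`, Mathlib `Chebyshev.psi_sub_theta_le`, for the term
`(ψ − ϑ)/φ(q)`; the prime-power part `R_{q,a}(n) ≤ R_{q,a}(⌊x⌋)` of the class itself is kept). [folklore] -/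
theorem abs_chebyshevThetaDisc_le_primeAPError {q : ℕ} (hq : q ≠ 0) (a : (ZMod q)ˣ) {x : ℝ}
    (hx : 1 ≤ x) {n : ℕ} (hnx : (n : ℝ) ≤ x) :
    |chebyshevThetaDisc q a n| ≤
      primeAPError x q + (primeAPError x 1 + 2 * Real.sqrt x * Real.log x) / Nat.totient q +
        ⨆ b : (ZMod q)ˣ, chebyshevPsiModNotPrime q b ⌊x⌋₊ := by
  have hφ : (0 : ℝ) < Nat.totient q := by exact_mod_cast Nat.totient_pos.mpr (Nat.pos_of_ne_zero hq)
  have hE0 := primeAPError_nonneg x q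
  have hE1 := primeAPError_nonneg x 1
  have hlx : 0 ≤ Real.log x := Real.log_nonneg hx
  have hS0 := iSup_chebyshevPsiModNotPrime_nonneg q ⌊x⌋₊
  rcases Nat.eq_zero_or_pos n with rfl | hn
  · rw [chebyshevThetaDisc_zero, abs_zero]; positivity
  have hn1 : (1 : ℝ) ≤ n := by exact_mod_cast hn
  have hnfl : n ≤ ⌊x⌋₊ := Nat.le_floor hnx
  refine (abs_chebyshevThetaDisc_le q a n).trans (add_le_add_three ?_ ?_ ?_)
  · exact abs_chebyshevPsiDisc_le_primeAPError hq a hn hnx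
  · rw [add_div, add_div]
    refine add_le_add (div_le_div_of_nonneg_right (abs_psi_sub_le_primeAPError_one hn hnx) hφ.le)
      (div_le_div_of_nonneg_right ?_ hφ.le)
    refine (Chebyshev.psi_sub_theta_le hn1).trans ?_
    have h1 : Real.sqrt n ≤ Real.sqrt x := Real.sqrt_le_sqrt hnx
    have h2 : Real.log n ≤ Real.log x := Real.log_le_log (by linarith) hnx
    have h3 : 0 ≤ Real.log (n : ℝ) := Real.log_nonneg hn1
    gcongr
  · exact (chebyshevPsiModNotPrime_mono q a hnfl).trans (chebyshevPsiModNotPrime_le_iSup a ⌊x⌋₊)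

/-- `π(N; q, a) − π(N)/φ(q)`, as it appears in `PrimesHaveLevelPi`, equals `primeCountingDisc`. [folklore] -/
theorem primeCountingMod_sub_div_eq {q : ℕ} (hq : q ≠ 0) (a : ZMod q) (N : ℕ) :
    (LevelOfDistribution.primeCountingMod q a.val N : ℝ) - (Nat.primeCounting N : ℝ) / Nat.totient q =
      primeCountingDisc q a N := by
  haveI : NeZero q := ⟨hq⟩
  have h1 : (LevelOfDistribution.primeCountingMod q a.val N : ℝ) =
      ∑ n ∈ range (N + 1), if n.Prime then apIndicator q a n else 0 := by
    rw [LevelOfDistribution.primeCountingMod, natCast_card_filter]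
    refine sum_congr rfl fun n _ => ?_
    by_cases hp : n.Prime
    · have hiff : n ≡ a.val [MOD q] ↔ (n : ZMod q) = a := by
        rw [← ZMod.natCast_eq_natCast_iff, ZMod.natCast_zmod_val]
      simp only [hp, true_and, if_true, apIndicator, hiff]
    · simp [hp]
  have h2 : (Nat.primeCounting N : ℝ) = ∑ n ∈ range (N + 1), if n.Prime then (1 : ℝ) else 0 := by
    rw [← Nat.primesLE_card_eq_primeCounting, Nat.primesLE_eq_filter_range, natCast_card_filter]
  rw [h1, h2, primeCountingDisc, sum_div, ← sum_sub_distrib]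
  refine sum_congr rfl fun n _ => ?_
  split_ifs <;> ring

/-- **`E_π ≪ E_ψ`.** For `q ≠ 0` and `x ≥ 1`,
`E_π(x; q) ≤ (E_ψ(x; q) + (E_ψ(x; 1) + 2 √x log x)/φ(q) + max_{(b,q)=1} R_{q,b}(⌊x⌋)) / log 2`. [folklore] -/
theorem iSup_primeCountingDisc_le {q : ℕ} (hq : q ≠ 0) {x : ℝ} (hx : 1 ≤ x) :
    (⨆ y : Set.Icc 1 x, ⨆ a : (ZMod q)ˣ,
        |(LevelOfDistribution.primeCountingMod q (a : ZMod q).val ⌊(y : ℝ)⌋₊ : ℝ) -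
          (Nat.primeCounting ⌊(y : ℝ)⌋₊ : ℝ) / Nat.totient q|) ≤
      (primeAPError x q + (primeAPError x 1 + 2 * Real.sqrt x * Real.log x) / Nat.totient q +
        ⨆ b : (ZMod q)ˣ, chebyshevPsiModNotPrime q b ⌊x⌋₊) / Real.log 2 := by
  have hφ : (0 : ℝ) < Nat.totient q := by exact_mod_cast Nat.totient_pos.mpr (Nat.pos_of_ne_zero hq)
  have hB : 0 ≤ (primeAPError x q + (primeAPError x 1 + 2 * Real.sqrt x * Real.log x) / Nat.totient q +
      ⨆ b : (ZMod q)ˣ, chebyshevPsiModNotPrime q b ⌊x⌋₊) / Real.log 2 := by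
    have := primeAPError_nonneg x q
    have := primeAPError_nonneg x 1
    have := Real.log_nonneg hx
    have := iSup_chebyshevPsiModNotPrime_nonneg q ⌊x⌋₊
    positivity
  refine Real.iSup_le (fun y => Real.iSup_le (fun a => ?_) hB) hB
  rw [primeCountingMod_sub_div_eq hq]
  refine abs_primeCountingDisc_le fun n hn => abs_chebyshevThetaDisc_le_primeAPError hq a hx ?_
  have hy0 : (0 : ℝ) ≤ y := zero_le_one.trans y.2.1
  exact ((Nat.cast_le.mpr hn).trans (Nat.floor_le hy0)).trans y.2.2

/-! ### `∑_{q ≤ Q} 1/φ(q) ≤ (1 + log Q)²`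

Elementary bound for the reciprocal totient sum from `q ≤ φ(q) τ(q)` and the harmonic-sum lemmas
`sum_sum_divisors_div_le`, `sum_Icc_one_div_le_one_add_log` of `PrimePowersInProgressions.lean`; kept
`private` since it is only proof plumbing here (a sharper `≪ log Q` holds but is not needed). -/

/-- `q ≤ φ(q) τ(q)` (from `q = ∑_{d ∣ q} φ(d)` and `φ(d) ≤ φ(q)` for `d ∣ q`). [folklore] -/
private theorem self_le_totient_mul_card_divisors (q : ℕ) :
    q ≤ Nat.totient q * q.divisors.card := by
  rcases Nat.eq_zero_or_pos q with rfl | hq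
  · simp
  calc q = ∑ d ∈ q.divisors, Nat.totient d := (Nat.sum_totient q).symm
    _ ≤ ∑ d ∈ q.divisors, Nat.totient q := sum_le_sum fun d hd =>
        Nat.le_of_dvd (Nat.totient_pos.mpr hq) (Nat.totient_dvd_of_dvd (Nat.dvd_of_mem_divisors hd))
    _ = _ := by rw [sum_const, smul_eq_mul, mul_comm]

/-- `∑_{1 ≤ q ≤ Q} 1/φ(q) ≤ (1 + log Q)²` (via `1/φ(q) ≤ τ(q)/q` and `∑_{q ≤ Q} τ(q)/q ≤ H_Q²`). [folklore] -/
private theorem sum_one_div_totient_le (Q : ℕ) :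
    ∑ q ∈ Icc 1 Q, (1 : ℝ) / Nat.totient q ≤ (1 + Real.log Q) ^ 2 := by
  have h1 : ∑ q ∈ Icc 1 Q, (1 : ℝ) / Nat.totient q ≤ ∑ q ∈ Icc 1 Q, (q.divisors.card : ℝ) / q := by
    refine sum_le_sum fun q hq => ?_
    have hq1 : 1 ≤ q := (mem_Icc.mp hq).1
    have hφ : (0 : ℝ) < Nat.totient q := by exact_mod_cast Nat.totient_pos.mpr hq1
    have hq0 : (0 : ℝ) < q := by exact_mod_cast hq1
    rw [div_le_div_iff₀ hφ hq0, one_mul, mul_comm]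
    exact_mod_cast self_le_totient_mul_card_divisors q
  have h2 : ∑ q ∈ Icc 1 Q, (q.divisors.card : ℝ) / q ≤ (∑ d ∈ Icc 1 Q, (1 : ℝ) / d) ^ 2 := by
    simpa [sq, Finset.sum_const, nsmul_eq_mul, one_div] using
      sum_sum_divisors_div_le (fun _ => (1 : ℝ)) (fun _ => zero_le_one) Q
  have h0 : 0 ≤ ∑ d ∈ Icc 1 Q, (1 : ℝ) / d := sum_nonneg fun d _ => by positivity
  calc _ ≤ _ := h1
    _ ≤ _ := h2
    _ ≤ _ := pow_le_pow_left₀ h0 (sum_Icc_one_div_le_one_add_log Q) 2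

/-! ### Elementary asymptotic helpers -/

/-- `1 ≤ log x` for `x ≥ 3`. [folklore] -/
theorem one_le_log_of_three_le {x : ℝ} (hx : 3 ≤ x) : 1 ≤ Real.log x := by
  rw [← Real.log_exp 1]
  exact Real.log_le_log (Real.exp_pos 1) (Real.exp_one_lt_three.le.trans hx)

/-- For `x > 1` and `L = log x > 0`, `‖x / L^A‖ = x / L^A`. [folklore] -/
theorem norm_div_log_rpow {x : ℝ} (hx : 1 < x) (A : ℝ) :
    ‖x / Real.log x ^ A‖ = x / Real.log x ^ A := by
  rw [Real.norm_eq_abs, abs_of_pos]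
  exact div_pos (by linarith) (Real.rpow_pos_of_pos (Real.log_pos hx) A)

/-- Below level `1` the modulus range is empty: if `η < 0` and `x > 1` then `Icc 1 ⌊x^η⌋ = ∅`, so
any sum over it vanishes. [folklore] -/
theorem sum_Icc_floor_rpow_eq_zero {η : ℝ} (hη : η < 0) {x : ℝ} (hx : 1 < x) (F : ℕ → ℝ) :
    ∑ q ∈ Icc 1 ⌊x ^ η⌋₊, F q = 0 := by
  have : ⌊x ^ η⌋₊ = 0 := Nat.floor_eq_zero.mpr (Real.rpow_lt_one_of_one_lt_of_neg hx hη)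
  rw [this]
  rfl

/-- Below level `1` every level-of-distribution sum is eventually `0`, hence `O` of anything. [folklore] -/
theorem isBigO_sum_Icc_floor_rpow_of_neg {η : ℝ} (hη : η < 0) (F : ℝ → ℕ → ℝ) (g : ℝ → ℝ) :
    (fun x : ℝ => ∑ q ∈ Icc 1 ⌊x ^ η⌋₊, F x q) =O[atTop] g := by
  refine IsBigO.of_bound 0 ?_
  filter_upwards [eventually_gt_atTop (1 : ℝ)] with x hx
  rw [sum_Icc_floor_rpow_eq_zero hη hx, norm_zero, zero_mul]

/-- For `x ≥ 1` and `0 ≤ η`, the modulus `q = 1` is in range: `1 ≤ ⌊x^η⌋`. [folklore] -/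
theorem one_le_floor_rpow {η : ℝ} (hη : 0 ≤ η) {x : ℝ} (hx : 1 ≤ x) : 1 ≤ ⌊x ^ η⌋₊ :=
  Nat.le_floor (by simpa using Real.one_le_rpow hx hη)

/-- For `x ≥ 1` and `η ≤ 1`, `⌊x^η⌋ ≤ x`. [folklore] -/
theorem floor_rpow_le_self {η : ℝ} (hη : η ≤ 1) {x : ℝ} (hx : 1 ≤ x) : (⌊x ^ η⌋₊ : ℝ) ≤ x :=
  (Nat.floor_le (Real.rpow_nonneg (by linarith) η)).trans
    (by simpa using Real.rpow_le_rpow_of_exponent_le hx hη)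

/-! ### The vacuous range `θ ≤ 0` -/

/-- For `θ ≤ 0` the `ψ`-form holds vacuously (empty modulus range). [folklore] -/
theorem PrimesHaveLevel.of_nonpos {θ : ℝ} (hθ : θ ≤ 0) : PrimesHaveLevel θ :=
  fun _ _ _ hε => isBigO_sum_Icc_floor_rpow_of_neg (by linarith) (fun x q => primeAPError x q) _

/-- For `θ ≤ 0` the `π`-form holds vacuously (empty modulus range). [folklore] -/
theorem PrimesHaveLevelPi.of_nonpos {θ : ℝ} (hθ : θ ≤ 0) : PrimesHaveLevelPi θ :=
  fun _ _ _ hε => isBigO_sum_Icc_floor_rpow_of_neg (by linarith)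
    (fun x q => ⨆ y : Set.Icc 1 x, ⨆ a : (ZMod q)ˣ,
      |(LevelOfDistribution.primeCountingMod q (a : ZMod q).val ⌊(y : ℝ)⌋₊ : ℝ) -
        (Nat.primeCounting ⌊(y : ℝ)⌋₊ : ℝ) / Nat.totient q|) _

/-- The equivalence of the two forms in the vacuous range `θ ≤ 0`. [folklore] -/
theorem primesHaveLevel_iff_primesHaveLevelPi_of_nonpos {θ : ℝ} (hθ : θ ≤ 0) :
    PrimesHaveLevel θ ↔ PrimesHaveLevelPi θ :=
  ⟨fun _ => PrimesHaveLevelPi.of_nonpos hθ, fun _ => PrimesHaveLevel.of_nonpos hθ⟩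

/-! ### The `q = 1` term: `PrimesHaveLevel θ` with `θ > 0` contains the prime number theorem
with error `O_A(x/(log x)^A)` -/

/-- If the primes have level `x^θ` for some `θ > 0` (in the `ψ`-form, main term `y/φ(q)`), then
`ψ(x) = x + O_A(x/(log x)^A)` for every `A`: the `q = 1` term of the Bombieri–Vinogradov sum is
`max_{y ≤ x} |ψ(y) − y|`.  This shows that the direction `PrimesHaveLevelPi θ → PrimesHaveLevel θ`
(`θ > 0`) has the prime number theorem with error term `O_A(x/(log x)^A)`, for every `A`, as a
corollary (this log-power form — not the stronger `exp(−c √log x)` term itself — is exactly what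
`primesHaveLevel_iff_primesHaveLevelPi_of_isBigO` consumes). [folklore] -/
theorem PrimesHaveLevel.isBigO_chebyshevPsi_sub_self {θ : ℝ} (h : PrimesHaveLevel θ) (hθ : 0 < θ)
    (A : ℝ) : (fun x : ℝ => Chebyshev.psi x - x) =O[atTop] fun x : ℝ => x / Real.log x ^ A := by
  set A' : ℝ := max A 1 with hA'
  have hA'0 : 0 < A' := lt_of_lt_of_le zero_lt_one (le_max_right _ _)
  obtain ⟨C, hC⟩ := isBigO_iff.mp (h A' hA'0 (θ / 2) (by linarith))
  refine IsBigO.of_bound (C + 1) ?_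
  filter_upwards [hC, rpow_mul_log_le_div_eventually one_half_pos A',
    eventually_ge_atTop (3 : ℝ)] with x hCx hlo hx
  have hx1 : (1 : ℝ) ≤ x := by linarith
  have hL := one_le_log_of_three_le hx
  have hL0 : 0 < Real.log x := by linarith
  have hη : 0 ≤ θ - θ / 2 := by linarith
  -- the `q = 1` term is dominated by the whole (nonnegative) sum
  have hE1 : primeAPError x 1 ≤ ∑ q ∈ Icc 1 ⌊x ^ (θ - θ / 2)⌋₊, primeAPError x q :=
    single_le_sum (f := fun q => primeAPError x q) (fun q _ => primeAPError_nonneg x q)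
      (mem_Icc.mpr ⟨le_rfl, one_le_floor_rpow hη hx1⟩)
  rw [Real.norm_eq_abs, abs_of_nonneg (sum_nonneg fun q _ => primeAPError_nonneg x q),
    norm_div_log_rpow (by linarith) A'] at hCx
  -- `|ψ(x) − x| ≤ |ψ(⌊x⌋) − ⌊x⌋| + 1 ≤ E_ψ(x; 1) + 1`
  have hn1 : 1 ≤ ⌊x⌋₊ := Nat.le_floor (by simpa using hx1)
  have hnx : ((⌊x⌋₊ : ℕ) : ℝ) ≤ x := Nat.floor_le (by linarith)
  have hψ : |Chebyshev.psi x - x| ≤ primeAPError x 1 + 1 := by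
    have h1 := abs_psi_sub_le_primeAPError_one hn1 hnx
    have h2 : |((⌊x⌋₊ : ℕ) : ℝ) - x| ≤ 1 := by
      rw [abs_sub_comm, abs_of_nonneg (by linarith)]
      exact (sub_lt_iff_lt_add'.mpr (Nat.lt_floor_add_one x)).le
    calc |Chebyshev.psi x - x| = |(Chebyshev.psi ((⌊x⌋₊ : ℕ) : ℝ) - ⌊x⌋₊) + (((⌊x⌋₊ : ℕ) : ℝ) - x)| := by
          rw [Chebyshev.psi_eq_psi_coe_floor x]; ring_nf
      _ ≤ _ := (abs_add_le _ _).trans (add_le_add h1 h2)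
  -- `1 ≤ x^{1/2} log x ≤ x/(log x)^{A'}` and `x/(log x)^{A'} ≤ x/(log x)^A`
  have hone : 1 ≤ x / Real.log x ^ A' := by
    refine le_trans ?_ hlo
    have : (1 : ℝ) ≤ x ^ (1 - 1 / 2 : ℝ) := Real.one_le_rpow hx1 (by norm_num)
    nlinarith
  have hmono : x / Real.log x ^ A' ≤ x / Real.log x ^ A :=
    div_le_div_of_nonneg_left (by linarith) (Real.rpow_pos_of_pos hL0 A)
      (Real.rpow_le_rpow_of_exponent_le hL (le_max_left _ _))
  rw [Real.norm_eq_abs, norm_div_log_rpow (by linarith) A]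
  have hC0 : C * (x / Real.log x ^ A') ≤ C * (x / Real.log x ^ A) ∨ C < 0 := by
    by_cases hc : 0 ≤ C
    · exact Or.inl (mul_le_mul_of_nonneg_left hmono hc)
    · exact Or.inr (not_le.mp hc)
  rcases hC0 with hC0 | hC0
  · nlinarith [primeAPError_nonneg x 1]
  · -- `C < 0` forces the sum, hence `E_ψ(x;1)`, to vanish
    have hpos : 0 < x / Real.log x ^ A' := by linarith
    have : primeAPError x 1 ≤ 0 := hE1.trans (hCx.trans (by nlinarith))
    nlinarith [primeAPError_nonneg x 1]

/-! ### The prime-power term on average (from `PrimePowersInProgressions.lean`) -/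

/-- **Prime powers are negligible on average over the modulus**: for `ε > 0` and every real `A`,
eventually in `x`, for all `Q ≤ x^{1−ε}`,
`∑_{q ≤ Q} max_{(b,q)=1} R_{q,b}(⌊x⌋) ≤ x/(log x)^A`, where
`R_{q,b}(N) = ∑_{n ≤ N, n non-prime, n ≡ b (q)} Λ(n)`
(`eventually_sum_iSup_nonPrime_vonMangoldt_residue_le` of `PrimePowersInProgressions.lean`: the
number of `k`-th roots of a unit mod `q` is `≤ k^{ω(q)} 2^{v₂(q)}` and `∑_{q ≤ Q} k^{ω(q)}/q ≪_k (log Q)^k`).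
This is the extra input needed beyond the Bombieri–Vinogradov range, where the trivial bound
`R_{q,b}(N) ≤ ψ(N) − ϑ(N) ≤ 2 √N log N` suffices. [folklore] -/
theorem eventually_sum_iSup_chebyshevPsiModNotPrime_le {ε : ℝ} (hε : 0 < ε) (A : ℝ) :
    ∀ᶠ x : ℝ in atTop, ∀ Q : ℕ, (Q : ℝ) ≤ x ^ (1 - ε) →
      ∑ q ∈ Icc 1 Q, (⨆ b : (ZMod q)ˣ, chebyshevPsiModNotPrime q b ⌊x⌋₊) ≤
        x / Real.log x ^ A := by
  simp only [chebyshevPsiModNotPrime_eq_sum_ite]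
  exact eventually_sum_iSup_nonPrime_vonMangoldt_residue_le hε A

/-- `∑_{q ≤ Q} 1/φ(q) ≤ 4 (log x)²` for `1 ≤ Q ≤ x`, `x ≥ 3`. [folklore] -/
private theorem sum_one_div_totient_le_log_sq {Q : ℕ} {x : ℝ} (hQ1 : 1 ≤ Q) (hQx : (Q : ℝ) ≤ x)
    (hx : 3 ≤ x) : ∑ q ∈ Icc 1 Q, (1 : ℝ) / Nat.totient q ≤ 4 * Real.log x ^ (2 : ℝ) := by
  have hL := one_le_log_of_three_le hx
  have hlogQ : Real.log Q ≤ Real.log x := Real.log_le_log (by exact_mod_cast hQ1) hQx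
  have hlogQ0 : 0 ≤ Real.log Q := Real.log_natCast_nonneg Q
  refine (sum_one_div_totient_le Q).trans ?_
  rw [Real.rpow_two]; nlinarith

/-- `√x (log x)^3 ≤ x/(log x)^A` eventually, in the form used below: eventually
`2 √x log x · (4 (log x)²) ≤ 8 x/(log x)^A` and `4 (log x)² ≤ 4 x/(log x)^A`. [folklore] -/
private theorem eventually_sqrt_log_cube_le (A : ℝ) :
    ∀ᶠ x : ℝ in atTop, 2 * Real.sqrt x * Real.log x * (4 * Real.log x ^ (2 : ℝ)) ≤
        8 * (x / Real.log x ^ A) ∧ 4 * Real.log x ^ (2 : ℝ) ≤ 4 * (x / Real.log x ^ A) := by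
  filter_upwards [rpow_mul_log_le_div_eventually one_half_pos (A + 2),
    eventually_ge_atTop (3 : ℝ)] with x hlo hx
  have hx0 : 0 < x := by linarith
  have hx1 : 1 ≤ x := by linarith
  have hL := one_le_log_of_three_le hx
  have hL0 : 0 < Real.log x := by linarith
  have hsq : Real.sqrt x = x ^ (1 / 2 : ℝ) := Real.sqrt_eq_rpow x
  have hkey : Real.sqrt x * Real.log x ≤ x / Real.log x ^ (A + 2) := by
    rw [hsq, show (1 / 2 : ℝ) = 1 - 1 / 2 by norm_num]; exact hlo
  have hpowA : x / Real.log x ^ (A + 2) * Real.log x ^ (2 : ℝ) = x / Real.log x ^ A := by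
    rw [Real.rpow_add hL0]
    have : Real.log x ^ (2 : ℝ) ≠ 0 := (Real.rpow_pos_of_pos hL0 _).ne'
    field_simp
  have hL2 : 0 ≤ Real.log x ^ (2 : ℝ) := (Real.rpow_pos_of_pos hL0 _).le
  have hmain : Real.sqrt x * Real.log x * Real.log x ^ (2 : ℝ) ≤ x / Real.log x ^ A := by
    rw [← hpowA]; exact mul_le_mul_of_nonneg_right hkey hL2
  have hsx1 : 1 ≤ Real.sqrt x := by rw [← Real.sqrt_one]; exact Real.sqrt_le_sqrt hx1
  have hone : (1 : ℝ) ≤ Real.sqrt x * Real.log x := by nlinarith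
  constructor
  · have : 2 * Real.sqrt x * Real.log x * (4 * Real.log x ^ (2 : ℝ)) =
        8 * (Real.sqrt x * Real.log x * Real.log x ^ (2 : ℝ)) := by ring
    rw [this]; linarith
  · have : Real.log x ^ (2 : ℝ) ≤ Real.sqrt x * Real.log x * Real.log x ^ (2 : ℝ) :=
      le_mul_of_one_le_left hL2 hone
    linarith

/-! ### `ψ`-form implies `π`-form (`θ ≤ 1`, hence always) -/

/-- **Level of distribution, `ψ`-form ⇒ `π`-form** (`θ ≤ 1`).  If
`∑_{q ≤ x^{θ−ε}} max_{y ≤ x} max_{(a,q)=1} |ψ(y;q,a) − y/φ(q)| ≪ x/(log x)^A` for all `A, ε > 0`, then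
the same holds with `|π(y;q,a) − π(y)/φ(q)|` (Cojocaru–Murty, proof of Thm 9.2.1, PDF p. 99:
"proving (9.27) is equivalent to proving [the `ψ`-form]"; Iwaniec–Kowalski §17.1).
Proof: `E_π(x;q) ≤ (E_ψ(x;q) + (E_ψ(x;1) + 2√x log x)/φ(q) + max_b R_{q,b}(⌊x⌋))/log 2`
(`iSup_primeCountingDisc_le`), `∑_{q ≤ Q} 1/φ(q) ≤ (1 + log Q)²`, and the averaged prime-power
bound `eventually_sum_iSup_chebyshevPsiModNotPrime_le` for `Q = x^{θ−ε} ≤ x^{1−ε}`. [cite: CojocaruMurty2005, §9.2, proof of Thm. 9.2.1 (PDF p. 99)] -/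
theorem PrimesHaveLevel.primesHaveLevelPi_of_le_one {θ : ℝ} (h : PrimesHaveLevel θ) (hθ : θ ≤ 1) :
    PrimesHaveLevelPi θ := by
  intro A hA ε hε
  by_cases hneg : θ - ε < 0
  · exact isBigO_sum_Icc_floor_rpow_of_neg hneg _ _
  have hη : 0 ≤ θ - ε := not_lt.mp hneg
  obtain ⟨C₁, hC₁⟩ := isBigO_iff.mp (h A hA ε hε)
  obtain ⟨C₂, hC₂⟩ := isBigO_iff.mp (h (A + 2) (by linarith) ε hε)
  refine IsBigO.of_bound ((C₁ + 4 * C₂ + 9) / Real.log 2) ?_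
  filter_upwards [hC₁, hC₂, eventually_sqrt_log_cube_le A,
    eventually_sum_iSup_chebyshevPsiModNotPrime_le hε A, eventually_ge_atTop (3 : ℝ)]
    with x h1 h2 hlo hR hx
  have hx1 : (1 : ℝ) ≤ x := by linarith
  have hx0 : (0 : ℝ) < x := by linarith
  have hL := one_le_log_of_three_le hx
  have hL0 : 0 < Real.log x := by linarith
  have hlog2 : 0 < Real.log 2 := Real.log_pos one_lt_two
  set Q : ℕ := ⌊x ^ (θ - ε)⌋₊ with hQ
  have hQ1 : 1 ≤ Q := one_le_floor_rpow hη hx1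
  have hQx : (Q : ℝ) ≤ x := floor_rpow_le_self (by linarith) hx1
  have hQε : (Q : ℝ) ≤ x ^ (1 - ε) :=
    (Nat.floor_le (Real.rpow_nonneg hx0.le _)).trans
      (Real.rpow_le_rpow_of_exponent_le hx1 (by linarith))
  have hS0 : 0 ≤ ∑ q ∈ Icc 1 Q, primeAPError x q := sum_nonneg fun q _ => primeAPError_nonneg x q
  rw [Real.norm_eq_abs, abs_of_nonneg hS0, norm_div_log_rpow (by linarith)] at h1 h2
  have hE1 : primeAPError x 1 ≤ C₂ * (x / Real.log x ^ (A + 2)) :=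
    (single_le_sum (f := fun q => primeAPError x q) (fun q _ => primeAPError_nonneg x q)
      (mem_Icc.mpr ⟨le_rfl, hQ1⟩)).trans h2
  set R : ℕ → ℝ := fun q => ⨆ b : (ZMod q)ˣ, chebyshevPsiModNotPrime q b ⌊x⌋₊ with hRdef
  have hRsum : ∑ q ∈ Icc 1 Q, R q ≤ x / Real.log x ^ A := hR Q hQε
  set T : ℝ := 2 * Real.sqrt x * Real.log x with hT
  -- pointwise bound on the summands, then sum over `q`
  have hsum : ∑ q ∈ Icc 1 Q, (⨆ y : Set.Icc 1 x, ⨆ a : (ZMod q)ˣ,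
      |(LevelOfDistribution.primeCountingMod q (a : ZMod q).val ⌊(y : ℝ)⌋₊ : ℝ) -
        (Nat.primeCounting ⌊(y : ℝ)⌋₊ : ℝ) / Nat.totient q|) ≤
      ∑ q ∈ Icc 1 Q, (primeAPError x q + (primeAPError x 1 + T) / Nat.totient q + R q) /
        Real.log 2 :=
    sum_le_sum fun q hq => iSup_primeCountingDisc_le (Nat.one_le_iff_ne_zero.mp (mem_Icc.mp hq).1) hx1
  have hlin : ∑ q ∈ Icc 1 Q, (primeAPError x 1 + T) / (Nat.totient q : ℝ) =
      (primeAPError x 1 + T) * ∑ q ∈ Icc 1 Q, (1 : ℝ) / Nat.totient q := by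
    rw [mul_sum]
    exact sum_congr rfl fun q _ => by ring
  have hsplit : ∑ q ∈ Icc 1 Q, (primeAPError x q + (primeAPError x 1 + T) / Nat.totient q + R q) /
        Real.log 2 =
      ((∑ q ∈ Icc 1 Q, primeAPError x q) +
        (primeAPError x 1 + T) * (∑ q ∈ Icc 1 Q, (1 : ℝ) / Nat.totient q) +
        ∑ q ∈ Icc 1 Q, R q) / Real.log 2 := by
    rw [← sum_div, sum_add_distrib, sum_add_distrib, hlin]
  -- the terms
  have hφsum := sum_one_div_totient_le_log_sq hQ1 hQx hx
  have hφsum0 : 0 ≤ ∑ q ∈ Icc 1 Q, (1 : ℝ) / Nat.totient q := sum_nonneg fun q _ => by positivity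
  have hpowA : x / Real.log x ^ (A + 2) * (4 * Real.log x ^ (2 : ℝ)) = 4 * (x / Real.log x ^ A) := by
    rw [Real.rpow_add hL0]
    have : Real.log x ^ (2 : ℝ) ≠ 0 := (Real.rpow_pos_of_pos hL0 _).ne'
    field_simp
  have hC₂0 : 0 ≤ C₂ * (x / Real.log x ^ (A + 2)) := (primeAPError_nonneg x 1).trans hE1
  have hT2a : primeAPError x 1 * (∑ q ∈ Icc 1 Q, (1 : ℝ) / Nat.totient q) ≤
      4 * C₂ * (x / Real.log x ^ A) := by
    calc primeAPError x 1 * (∑ q ∈ Icc 1 Q, (1 : ℝ) / Nat.totient q)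
        ≤ (C₂ * (x / Real.log x ^ (A + 2))) * (4 * Real.log x ^ (2 : ℝ)) :=
          mul_le_mul hE1 hφsum hφsum0 hC₂0
      _ = 4 * C₂ * (x / Real.log x ^ A) := by rw [mul_assoc, hpowA]; ring
  have hT2b : T * (∑ q ∈ Icc 1 Q, (1 : ℝ) / Nat.totient q) ≤ 8 * (x / Real.log x ^ A) :=
    (mul_le_mul_of_nonneg_left hφsum (by positivity)).trans hlo.1
  have hnn : 0 ≤ ∑ q ∈ Icc 1 Q, (⨆ y : Set.Icc 1 x, ⨆ a : (ZMod q)ˣ,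
      |(LevelOfDistribution.primeCountingMod q (a : ZMod q).val ⌊(y : ℝ)⌋₊ : ℝ) -
        (Nat.primeCounting ⌊(y : ℝ)⌋₊ : ℝ) / Nat.totient q|) :=
    sum_nonneg fun q _ => Real.iSup_nonneg fun _ => Real.iSup_nonneg fun _ => abs_nonneg _
  rw [Real.norm_eq_abs, abs_of_nonneg hnn, norm_div_log_rpow (by linarith)]
  refine (hsum.trans_eq hsplit).trans ?_
  rw [div_mul_eq_mul_div, le_div_iff₀ hlog2, div_mul_cancel₀ _ hlog2.ne', add_mul]
  linarith

/-- **`ψ`-form ⇒ `π`-form, unconditionally and for every `θ`**: `PrimesHaveLevel θ` forces `θ ≤ 1`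
(`PrimesHaveLevel.le_one`), and for `θ ≤ 1` this is `primesHaveLevelPi_of_le_one`. [cite: CojocaruMurty2005, §9.2, proof of Thm. 9.2.1 (PDF p. 99)] -/
theorem PrimesHaveLevel.primesHaveLevelPi {θ : ℝ} (h : PrimesHaveLevel θ) : PrimesHaveLevelPi θ :=
  h.primesHaveLevelPi_of_le_one h.le_one

/-! ### The prime number theorem input -/

/-- The de la Vallée Poussin error term in `O`-form: from the named fact
`ChebyshevPsiDeLaValleePoussin` (`Literature/NumberTheory/LFunctions/PrimeNumberTheoremErrorTerm.lean`,
Montgomery–Vaughan Thm 6.9 (6.12)) one has `ψ(x) − x = O_A(x/(log x)^A)` for every real `A`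
(via its proved corollary `ChebyshevPsiDeLaValleePoussin.logPow`).  This is the only input to
`primesHaveLevel_iff_primesHaveLevelPi_of` that is not proved in this library, and by
`PrimesHaveLevel.isBigO_chebyshevPsi_sub_self` an input of this strength is unavoidable. [folklore] -/
theorem _root_.Literature.NumberTheory.LFunctions.ChebyshevPsiDeLaValleePoussin.isBigO_logPow (h : LFunctions.ChebyshevPsiDeLaValleePoussin) (A : ℝ) :
    (fun x : ℝ => Chebyshev.psi x - x) =O[atTop] fun x : ℝ => x / Real.log x ^ A := by
  obtain ⟨C, hC⟩ := h.logPow A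
  refine IsBigO.of_bound C ?_
  filter_upwards [eventually_ge_atTop (2 : ℝ)] with x hx
  rw [Real.norm_eq_abs, norm_div_log_rpow (by linarith), ← mul_div_assoc]
  exact hC x hx

/-! ### `π`-form implies `ψ`-form for `θ ≤ 1`, given the prime number theorem with error term -/

/-- `|π(N;q,a) − π(N)/φ(q)| ≤ N + 1` (each of the `N + 1` summands has absolute value `≤ 1`). [folklore] -/
theorem abs_primeCountingDisc_le_succ (q : ℕ) (a : ZMod q) (N : ℕ) :
    |primeCountingDisc q a N| ≤ N + 1 := by
  refine (abs_sum_le_sum_abs _ _).trans ?_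
  calc ∑ n ∈ range (N + 1), |(if n.Prime then apIndicator q a n - 1 / (Nat.totient q : ℝ) else 0)|
      ≤ ∑ n ∈ range (N + 1), (1 : ℝ) := sum_le_sum fun n _ => by
        split_ifs
        · have h0 := apIndicator_nonneg q a n
          have h1 := apIndicator_le_one q a n
          have h2 : 0 ≤ 1 / (Nat.totient q : ℝ) := by positivity
          have h3 : 1 / (Nat.totient q : ℝ) ≤ 1 := by
            rcases Nat.eq_zero_or_pos q with rfl | hq
            · simp
            · exact div_le_one_of_le₀ (by exact_mod_cast Nat.totient_pos.mpr hq) (by positivity)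
          rw [abs_le]; constructor <;> linarith
        · simp
    _ = N + 1 := by simp

/-- The range of the outer supremum in `E_π(x; q)` is bounded above (by `x + 1`). [folklore] -/
theorem bddAbove_range_primeCountingDisc (x : ℝ) {q : ℕ} (hq : q ≠ 0) :
    BddAbove (Set.range fun y : Set.Icc (1 : ℝ) x => ⨆ a : (ZMod q)ˣ,
      |(LevelOfDistribution.primeCountingMod q (a : ZMod q).val ⌊(y : ℝ)⌋₊ : ℝ) -
        (Nat.primeCounting ⌊(y : ℝ)⌋₊ : ℝ) / Nat.totient q|) := by
  refine ⟨x + 1, ?_⟩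
  rintro _ ⟨y, rfl⟩
  have hy0 : (0 : ℝ) ≤ y := zero_le_one.trans y.2.1
  refine Real.iSup_le (fun a => ?_) (by linarith [y.2.1, y.2.2])
  rw [primeCountingMod_sub_div_eq hq]
  refine (abs_primeCountingDisc_le_succ q a _).trans ?_
  have : ((⌊(y : ℝ)⌋₊ : ℕ) : ℝ) ≤ x := (Nat.floor_le hy0).trans y.2.2
  linarith

/-- For `1 ≤ n ≤ x` and `q ≠ 0`, `|π(n;q,a) − π(n)/φ(q)| ≤ E_π(x; q)`. [folklore] -/
theorem abs_primeCountingDisc_le_iSup {q : ℕ} (hq : q ≠ 0) (a : (ZMod q)ˣ) {x : ℝ} {n : ℕ}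
    (hn1 : 1 ≤ n) (hnx : (n : ℝ) ≤ x) :
    |primeCountingDisc q a n| ≤ ⨆ y : Set.Icc 1 x, ⨆ a : (ZMod q)ˣ,
      |(LevelOfDistribution.primeCountingMod q (a : ZMod q).val ⌊(y : ℝ)⌋₊ : ℝ) -
        (Nat.primeCounting ⌊(y : ℝ)⌋₊ : ℝ) / Nat.totient q| := by
  haveI : NeZero q := ⟨hq⟩
  have h1 : (1 : ℝ) ≤ n := by exact_mod_cast hn1
  refine le_ciSup_of_le (bddAbove_range_primeCountingDisc x hq) ⟨n, h1, hnx⟩ ?_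
  refine le_trans ?_ (le_ciSup (f := fun a : (ZMod q)ˣ =>
    |(LevelOfDistribution.primeCountingMod q (a : ZMod q).val ⌊((n : ℝ))⌋₊ : ℝ) -
      (Nat.primeCounting ⌊((n : ℝ))⌋₊ : ℝ) / Nat.totient q|) (Set.finite_range _).bddAbove a)
  simp only [Nat.floor_natCast]
  rw [primeCountingMod_sub_div_eq hq]

/-- **`E_ψ ≪ E_π · log`.** For `q ≠ 0`, `x ≥ 1` and any `F ≥ 0` with `|ψ(n) − n| ≤ F` for all integers
`1 ≤ n ≤ x`:
`E_ψ(x; q) ≤ 2 log x · E_π(x; q) + (F + 2 √x log x + 1)/φ(q) + max_{(b,q)=1} R_{q,b}(⌊x⌋)`. [folklore] -/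
theorem primeAPError_le_of_primeCountingDisc {q : ℕ} (hq : q ≠ 0) {x : ℝ} (hx : 1 ≤ x) {F : ℝ}
    (hF0 : 0 ≤ F) (hF : ∀ n : ℕ, 1 ≤ n → (n : ℝ) ≤ x → |Chebyshev.psi n - n| ≤ F) :
    primeAPError x q ≤
      2 * Real.log x * (⨆ y : Set.Icc 1 x, ⨆ a : (ZMod q)ˣ,
        |(LevelOfDistribution.primeCountingMod q (a : ZMod q).val ⌊(y : ℝ)⌋₊ : ℝ) -
          (Nat.primeCounting ⌊(y : ℝ)⌋₊ : ℝ) / Nat.totient q|) +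
      (F + 2 * Real.sqrt x * Real.log x + 1) / Nat.totient q +
      ⨆ b : (ZMod q)ˣ, chebyshevPsiModNotPrime q b ⌊x⌋₊ := by
  set Eπ : ℝ := ⨆ y : Set.Icc 1 x, ⨆ a : (ZMod q)ˣ,
        |(LevelOfDistribution.primeCountingMod q (a : ZMod q).val ⌊(y : ℝ)⌋₊ : ℝ) -
          (Nat.primeCounting ⌊(y : ℝ)⌋₊ : ℝ) / Nat.totient q| with hEπ
  set S : ℝ := ⨆ b : (ZMod q)ˣ, chebyshevPsiModNotPrime q b ⌊x⌋₊ with hS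
  have hEπ0 : 0 ≤ Eπ := Real.iSup_nonneg fun _ => Real.iSup_nonneg fun _ => abs_nonneg _
  have hS0 : 0 ≤ S := iSup_chebyshevPsiModNotPrime_nonneg q ⌊x⌋₊
  have hφ0 : (0 : ℝ) < Nat.totient q := by exact_mod_cast Nat.totient_pos.mpr (Nat.pos_of_ne_zero hq)
  have hlx : 0 ≤ Real.log x := Real.log_nonneg hx
  have hB : 0 ≤ 2 * Real.log x * Eπ + (F + 2 * Real.sqrt x * Real.log x + 1) / Nat.totient q + S := by
    positivity
  refine Real.iSup_le (fun y => Real.iSup_le (fun a => ?_) hB) hB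
  have hy1 : (1 : ℝ) ≤ y := y.2.1
  have hyx : (y : ℝ) ≤ x := y.2.2
  set N : ℕ := ⌊(y : ℝ)⌋₊ with hN
  have hN1 : 1 ≤ N := Nat.le_floor (by simpa using hy1)
  have hNy : (N : ℝ) ≤ y := Nat.floor_le (by linarith)
  have hNx : (N : ℝ) ≤ x := hNy.trans hyx
  have hN1' : (1 : ℝ) ≤ N := by exact_mod_cast hN1
  have hNfl : N ≤ ⌊x⌋₊ := Nat.floor_le_floor hyx
  -- replace `y` by `N = ⌊y⌋` at the cost of `1/φ(q)`
  have hfl : LevelOfDistribution.chebyshevPsiMod q a y = LevelOfDistribution.chebyshevPsiMod q a N := by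
    simp only [LevelOfDistribution.chebyshevPsiMod, Nat.floor_natCast, hN]
  have hstep : |LevelOfDistribution.chebyshevPsiMod q a y - (y : ℝ) / Nat.totient q| ≤
      |chebyshevPsiDisc q a N| + 1 / Nat.totient q := by
    have hdiff : |((N : ℝ) - y) / Nat.totient q| ≤ 1 / Nat.totient q := by
      rw [abs_div, Nat.abs_cast, abs_sub_comm, abs_of_nonneg (by linarith)]
      refine div_le_div_of_nonneg_right ?_ hφ0.le
      have := Nat.lt_floor_add_one (y : ℝ); rw [← hN] at this; linarith
    calc |LevelOfDistribution.chebyshevPsiMod q a y - (y : ℝ) / Nat.totient q|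
        = |chebyshevPsiDisc q a N + ((N : ℝ) - y) / Nat.totient q| := by
          rw [hfl, chebyshevPsiDisc]; ring_nf
      _ ≤ _ := (abs_add_le _ _).trans (add_le_add le_rfl hdiff)
  -- the `ϑ`-discrepancy at `N` from the `π`-discrepancies
  have hθN : |chebyshevThetaDisc q a N| ≤ 2 * Eπ * Real.log N :=
    abs_chebyshevThetaDisc_le_of_primeCountingDisc fun n hn => by
      rcases Nat.eq_zero_or_pos n with rfl | hn0
      · rw [primeCountingDisc_zero, abs_zero]; exact hEπ0
      · exact abs_primeCountingDisc_le_iSup hq a hn0 ((Nat.cast_le.mpr hn).trans hNx)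
  have hlogN : Real.log N ≤ Real.log x := Real.log_le_log (by linarith) hNx
  have h1 : |chebyshevThetaDisc q a N| ≤ 2 * Real.log x * Eπ := by
    calc _ ≤ 2 * Eπ * Real.log N := hθN
      _ ≤ 2 * Eπ * Real.log x := mul_le_mul_of_nonneg_left hlogN (by positivity)
      _ = _ := by ring
  have h2 : |Chebyshev.psi N - N| ≤ F := hF N hN1 hNx
  have h3 : Chebyshev.psi N - Chebyshev.theta N ≤ 2 * Real.sqrt x * Real.log x := by
    refine (Chebyshev.psi_sub_theta_le hN1').trans ?_
    have := Real.sqrt_le_sqrt hNx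
    have := Real.log_nonneg hN1'
    gcongr
  have h4 := abs_chebyshevPsiDisc_le q a N
  have h5 : chebyshevPsiModNotPrime q a N ≤ S :=
    (chebyshevPsiModNotPrime_mono q a hNfl).trans (chebyshevPsiModNotPrime_le_iSup a ⌊x⌋₊)
  have h6 : (|Chebyshev.psi N - N| + (Chebyshev.psi N - Chebyshev.theta N)) / Nat.totient q ≤
      (F + 2 * Real.sqrt x * Real.log x) / Nat.totient q :=
    div_le_div_of_nonneg_right (add_le_add h2 h3) hφ0.le
  have h7 : (F + 2 * Real.sqrt x * Real.log x) / Nat.totient q + 1 / Nat.totient q =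
      (F + 2 * Real.sqrt x * Real.log x + 1) / Nat.totient q := by rw [← add_div]
  linarith

/-- The prime number theorem with error `O(x/(log x)^B)` gives a UNIFORM bound
`|ψ(n) − n| ≤ C x/(log x)^B` for all integers `1 ≤ n ≤ x` (for `n ≥ √x` by the hypothesis, for
`n < √x` by Chebyshev's bound `ψ(n) ≪ n ≤ √x`). [folklore] -/
theorem eventually_forall_abs_psi_sub_le
    (hPNT : ∀ A : ℝ, (fun x : ℝ => Chebyshev.psi x - x) =O[atTop] fun x : ℝ => x / Real.log x ^ A)
    {B : ℝ} (hB : 0 ≤ B) :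
    ∃ C : ℝ, 0 ≤ C ∧ ∀ᶠ x : ℝ in atTop, ∀ n : ℕ, 1 ≤ n → (n : ℝ) ≤ x →
      |Chebyshev.psi n - n| ≤ C * (x / Real.log x ^ B) := by
  obtain ⟨C₀, hC₀⟩ := isBigO_iff.mp (hPNT B)
  obtain ⟨y₀, hy₀⟩ := eventually_atTop.mp hC₀
  set y₁ : ℝ := max y₀ 3 with hy₁
  refine ⟨max C₀ 0 * 2 ^ B + (Real.log 4 + 5), by positivity, ?_⟩
  filter_upwards [eventually_ge_atTop (y₁ ^ 2), eventually_ge_atTop (3 : ℝ),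
    rpow_mul_log_le_div_eventually one_half_pos B] with x hx hx3 hlo n hn1 hnx
  have hL := one_le_log_of_three_le hx3
  have hL0 : 0 < Real.log x := by linarith
  have hx0 : 0 < x := by linarith
  have hy₁3 : 3 ≤ y₁ := le_max_right _ _
  have hsx : y₁ ≤ Real.sqrt x := by
    rw [show y₁ = Real.sqrt (y₁ ^ 2) by rw [Real.sqrt_sq (by linarith)]]
    exact Real.sqrt_le_sqrt hx
  have hmain : 0 ≤ x / Real.log x ^ B := (div_pos hx0 (Real.rpow_pos_of_pos hL0 B)).le
  -- `√x ≤ x / (log x)^B`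
  have hsqrt : Real.sqrt x ≤ x / Real.log x ^ B := by
    refine le_trans ?_ hlo
    rw [Real.sqrt_eq_rpow, show (1 - 1 / 2 : ℝ) = 1 / 2 by norm_num]
    exact le_mul_of_one_le_right (Real.rpow_nonneg hx0.le _) hL
  rcases lt_or_ge (n : ℝ) (Real.sqrt x) with hsmall | hlarge
  · -- small `n`: Chebyshev
    have hn0 : (0 : ℝ) ≤ n := Nat.cast_nonneg n
    have hψ := Chebyshev.psi_le_const_mul_self hn0
    have hψ0 := Chebyshev.psi_nonneg (n : ℝ)
    have hab : |Chebyshev.psi n - n| ≤ (Real.log 4 + 5) * Real.sqrt x := by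
      have hl4 : 0 ≤ Real.log 4 := Real.log_nonneg (by norm_num)
      rw [abs_le]; constructor <;> nlinarith
    calc |Chebyshev.psi n - n| ≤ (Real.log 4 + 5) * (x / Real.log x ^ B) :=
          hab.trans (mul_le_mul_of_nonneg_left hsqrt (by positivity))
      _ ≤ _ := by
          have : 0 ≤ max C₀ 0 * 2 ^ B * (x / Real.log x ^ B) := by positivity
          nlinarith
  · -- large `n`: the hypothesis at `n`, with `log n ≥ (log x)/2`
    have hny : y₀ ≤ n := (le_max_left _ _).trans (hsx.trans hlarge)
    have hn3 : (3 : ℝ) ≤ n := hy₁3.trans (hsx.trans hlarge)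
    have hb := hy₀ n hny
    rw [Real.norm_eq_abs, norm_div_log_rpow (by linarith)] at hb
    have hlogn : Real.log x / 2 ≤ Real.log n := by
      rw [← Real.log_sqrt hx0.le]
      exact Real.log_le_log (by linarith) hlarge
    have hlogn0 : 0 < Real.log n := by linarith
    have hfrac : (n : ℝ) / Real.log n ^ B ≤ 2 ^ B * (x / Real.log x ^ B) := by
      have hpow : (Real.log x / 2) ^ B ≤ Real.log n ^ B :=
        Real.rpow_le_rpow (by linarith) hlogn hB
      have hpow' : (Real.log x / 2) ^ B = Real.log x ^ B / 2 ^ B := Real.div_rpow hL0.le zero_le_two B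
      calc (n : ℝ) / Real.log n ^ B ≤ x / (Real.log x / 2) ^ B :=
            div_le_div₀ hx0.le hnx (by rw [hpow']; positivity) hpow
        _ = 2 ^ B * (x / Real.log x ^ B) := by
            rw [hpow']; field_simp
    calc |Chebyshev.psi n - n| ≤ C₀ * ((n : ℝ) / Real.log n ^ B) := hb
      _ ≤ max C₀ 0 * ((n : ℝ) / Real.log n ^ B) :=
          mul_le_mul_of_nonneg_right (le_max_left _ _) (by positivity)
      _ ≤ max C₀ 0 * (2 ^ B * (x / Real.log x ^ B)) :=
          mul_le_mul_of_nonneg_left hfrac (le_max_right _ _)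
      _ ≤ _ := by
          have : 0 ≤ (Real.log 4 + 5) * (x / Real.log x ^ B) := by
            have hl4 : 0 ≤ Real.log 4 := Real.log_nonneg (by norm_num); positivity
          nlinarith

/-- **Level of distribution, `π`-form ⇒ `ψ`-form** (`θ ≤ 1`), given the prime number theorem in the
form `ψ(x) = x + O_A(x/(log x)^A)` for every `A` (Cojocaru–Murty, proof of Thm 9.2.1, PDF p. 99, where
the prime number theorem enters as (8.29)/(9.31); Iwaniec–Kowalski §17.1).
Proof: `E_ψ(x;q) ≤ 2 log x · E_π(x;q) + (F(x) + 2√x log x + 1)/φ(q) + max_b R_{q,b}(⌊x⌋)` with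
`F(x) = max_{n ≤ x} |ψ(n) − n| ≪ x/(log x)^{A+2}` (`primeAPError_le_of_primeCountingDisc`),
`∑_{q ≤ Q} 1/φ(q) ≤ (1 + log Q)²`, and the averaged prime-power bound
`eventually_sum_iSup_chebyshevPsiModNotPrime_le` for `Q = x^{θ−ε} ≤ x^{1−ε}`. [cite: CojocaruMurty2005, §9.2, proof of Thm. 9.2.1 (PDF p. 99)] -/
theorem PrimesHaveLevelPi.primesHaveLevel_of_isBigO {θ : ℝ} (h : PrimesHaveLevelPi θ)
    (hPNT : ∀ A : ℝ, (fun x : ℝ => Chebyshev.psi x - x) =O[atTop] fun x : ℝ => x / Real.log x ^ A)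
    (hθ : θ ≤ 1) : PrimesHaveLevel θ := by
  intro A hA ε hε
  by_cases hneg : θ - ε < 0
  · exact isBigO_sum_Icc_floor_rpow_of_neg hneg _ _
  have hη : 0 ≤ θ - ε := not_lt.mp hneg
  obtain ⟨C₁, hC₁⟩ := isBigO_iff.mp (h (A + 1) (by linarith) ε hε)
  obtain ⟨C₂, hC₂0, hC₂⟩ := eventually_forall_abs_psi_sub_le hPNT (B := A + 2) (by linarith)
  refine IsBigO.of_bound (2 * C₁ + 4 * C₂ + 13) ?_
  filter_upwards [hC₁, hC₂, eventually_sqrt_log_cube_le A,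
    eventually_sum_iSup_chebyshevPsiModNotPrime_le hε A, eventually_ge_atTop (3 : ℝ)]
    with x h1 h2 hlo hR hx
  have hx1 : (1 : ℝ) ≤ x := by linarith
  have hx0 : (0 : ℝ) < x := by linarith
  have hL := one_le_log_of_three_le hx
  have hL0 : 0 < Real.log x := by linarith
  set Q : ℕ := ⌊x ^ (θ - ε)⌋₊ with hQ
  have hQ1 : 1 ≤ Q := one_le_floor_rpow hη hx1
  have hQx : (Q : ℝ) ≤ x := floor_rpow_le_self (by linarith) hx1
  have hQε : (Q : ℝ) ≤ x ^ (1 - ε) :=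
    (Nat.floor_le (Real.rpow_nonneg hx0.le _)).trans
      (Real.rpow_le_rpow_of_exponent_le hx1 (by linarith))
  set F : ℝ := C₂ * (x / Real.log x ^ (A + 2)) with hF
  have hF0 : 0 ≤ F := mul_nonneg hC₂0 (div_pos hx0 (Real.rpow_pos_of_pos hL0 _)).le
  set T : ℝ := 2 * Real.sqrt x * Real.log x with hT
  have hT0 : 0 ≤ T := by positivity
  set R : ℕ → ℝ := fun q => ⨆ b : (ZMod q)ˣ, chebyshevPsiModNotPrime q b ⌊x⌋₊ with hRdef
  have hRsum : ∑ q ∈ Icc 1 Q, R q ≤ x / Real.log x ^ A := hR Q hQε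
  -- notation for the `π`-error
  set Eπ : ℕ → ℝ := fun q => ⨆ y : Set.Icc 1 x, ⨆ a : (ZMod q)ˣ,
      |(LevelOfDistribution.primeCountingMod q (a : ZMod q).val ⌊(y : ℝ)⌋₊ : ℝ) -
        (Nat.primeCounting ⌊(y : ℝ)⌋₊ : ℝ) / Nat.totient q| with hEπ
  have hEπ0 : ∀ q, 0 ≤ Eπ q := fun q =>
    Real.iSup_nonneg fun _ => Real.iSup_nonneg fun _ => abs_nonneg _
  have h1' : ∑ q ∈ Icc 1 Q, Eπ q ≤ C₁ * (x / Real.log x ^ (A + 1)) := by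
    rw [Real.norm_eq_abs, abs_of_nonneg (sum_nonneg fun q _ => hEπ0 q),
      norm_div_log_rpow (by linarith)] at h1
    exact h1
  -- pointwise bound and summation
  have hsum : ∑ q ∈ Icc 1 Q, primeAPError x q ≤
      ∑ q ∈ Icc 1 Q, (2 * Real.log x * Eπ q + (F + T + 1) / Nat.totient q + R q) :=
    sum_le_sum fun q hq => primeAPError_le_of_primeCountingDisc
      (Nat.one_le_iff_ne_zero.mp (mem_Icc.mp hq).1) hx1 hF0 h2
  have hlin : ∑ q ∈ Icc 1 Q, (F + T + 1) / (Nat.totient q : ℝ) =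
      (F + T + 1) * ∑ q ∈ Icc 1 Q, (1 : ℝ) / Nat.totient q := by
    rw [mul_sum]
    exact sum_congr rfl fun q _ => by ring
  have hsplit : ∑ q ∈ Icc 1 Q, (2 * Real.log x * Eπ q + (F + T + 1) / Nat.totient q + R q) =
      2 * Real.log x * (∑ q ∈ Icc 1 Q, Eπ q) + (F + T + 1) * (∑ q ∈ Icc 1 Q, (1 : ℝ) / Nat.totient q) +
        ∑ q ∈ Icc 1 Q, R q := by
    rw [sum_add_distrib, sum_add_distrib, hlin, ← mul_sum]
  have hT1 : 2 * Real.log x * (∑ q ∈ Icc 1 Q, Eπ q) ≤ 2 * C₁ * (x / Real.log x ^ A) := by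
    have hpow : Real.log x * (x / Real.log x ^ (A + 1)) = x / Real.log x ^ A := by
      rw [Real.rpow_add_one hL0.ne']; field_simp
    calc 2 * Real.log x * (∑ q ∈ Icc 1 Q, Eπ q) ≤ 2 * Real.log x * (C₁ * (x / Real.log x ^ (A + 1))) :=
          mul_le_mul_of_nonneg_left h1' (by positivity)
      _ = 2 * C₁ * (x / Real.log x ^ A) := by rw [← hpow]; ring
  have hφsum := sum_one_div_totient_le_log_sq hQ1 hQx hx
  have hφsum0 : 0 ≤ ∑ q ∈ Icc 1 Q, (1 : ℝ) / Nat.totient q := sum_nonneg fun q _ => by positivity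
  have hpowA : x / Real.log x ^ (A + 2) * (4 * Real.log x ^ (2 : ℝ)) = 4 * (x / Real.log x ^ A) := by
    rw [Real.rpow_add hL0]
    have : Real.log x ^ (2 : ℝ) ≠ 0 := (Real.rpow_pos_of_pos hL0 _).ne'
    field_simp
  have hT2a : F * (∑ q ∈ Icc 1 Q, (1 : ℝ) / Nat.totient q) ≤ 4 * C₂ * (x / Real.log x ^ A) := by
    calc F * (∑ q ∈ Icc 1 Q, (1 : ℝ) / Nat.totient q)
        ≤ (C₂ * (x / Real.log x ^ (A + 2))) * (4 * Real.log x ^ (2 : ℝ)) :=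
          mul_le_mul_of_nonneg_left hφsum hF0
      _ = 4 * C₂ * (x / Real.log x ^ A) := by rw [mul_assoc, hpowA]; ring
  have hT2b : T * (∑ q ∈ Icc 1 Q, (1 : ℝ) / Nat.totient q) ≤ 8 * (x / Real.log x ^ A) :=
    (mul_le_mul_of_nonneg_left hφsum hT0).trans hlo.1
  have hT2c : (1 : ℝ) * (∑ q ∈ Icc 1 Q, (1 : ℝ) / Nat.totient q) ≤ 4 * (x / Real.log x ^ A) := by
    rw [one_mul]; exact hφsum.trans hlo.2
  rw [Real.norm_eq_abs, abs_of_nonneg (sum_nonneg fun q _ => primeAPError_nonneg x q),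
    norm_div_log_rpow (by linarith)]
  refine (hsum.trans_eq hsplit).trans ?_
  have : (F + T + 1) * (∑ q ∈ Icc 1 Q, (1 : ℝ) / Nat.totient q) ≤ (4 * C₂ + 12) * (x / Real.log x ^ A) := by
    rw [add_mul, add_mul]; linarith
  linarith

/-- `π`-form ⇒ `ψ`-form for `θ ≤ 1`, from the named fact `ChebyshevPsiDeLaValleePoussin`
(Montgomery–Vaughan Thm 6.9 (6.12)). [cite: CojocaruMurty2005, §9.2, proof of Thm. 9.2.1 (PDF p. 99)] -/
theorem PrimesHaveLevelPi.primesHaveLevel {θ : ℝ} (h : PrimesHaveLevelPi θ)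
    (hPNT : LFunctions.ChebyshevPsiDeLaValleePoussin) (hθ : θ ≤ 1) : PrimesHaveLevel θ :=
  h.primesHaveLevel_of_isBigO hPNT.isBigO_logPow hθ

/-- Unconditionally: the Bombieri–Vinogradov theorem in the `ψ`-form (`BombieriVinogradovStatement`,
level `x^θ` for all `θ < 1/2`) implies the `π`-form for all `θ < 1/2`. [cite: IwaniecKowalski2004, Theorem 17.1] -/
theorem BombieriVinogradovStatement.primesHaveLevelPi (h : BombieriVinogradovStatement) {θ : ℝ}
    (hθ : θ < 1 / 2) : PrimesHaveLevelPi θ :=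
  (h θ hθ).primesHaveLevelPi

/-- Unconditionally: the Elliott–Halberstam conjecture in the `ψ`-form implies its `π`-form
(level `x^θ` for the discrepancies `π(y;q,a) − π(y)/φ(q)`, all `θ < 1`). [folklore] -/
theorem LevelOfDistribution.ElliottHalberstam.primesHaveLevelPi (h : LevelOfDistribution.ElliottHalberstam) {θ : ℝ} (hθ : θ < 1) :
    PrimesHaveLevelPi θ :=
  (h θ hθ).primesHaveLevelPi

/-! ### The range `θ > 1`: both forms are false

For `θ > 1` the modulus range `q ≤ x^{θ−ε}` contains, for `ε` small, all primes `q ∈ (4x, x^η]`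
with `η = (1+θ)/2 > 1`.  For such `q` and the residue `a = 2` one has `π(x; q, 2) = 1` and
`π(x)/φ(q) ≤ 2/3`, so each of these `≫ x^η/log x` moduli (Chebyshev's lower bound, Mathlib
`Chebyshev.pi_ge'`) contributes `≥ 1/3` to the `π`-sum, which is therefore not `O(x/log x)`:
`PrimesHaveLevelPi θ` fails.  That `PrimesHaveLevel θ` fails too is `PrimesHaveLevel.le_one` of
`LevelOfDistribution.lean`.  Hence the equivalence holds trivially in this range. -/

/-- The primes `≤ X` are among the primes in `(B, X]` together with the integers `≤ B`:
`π(⌊X⌋) ≤ #{q ≤ ⌊X⌋ prime, B < q} + B + 1`. [folklore] -/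
theorem primeCounting_floor_le_card_filter_add {X B : ℝ} (hB : 0 ≤ B) :
    (Nat.primeCounting ⌊X⌋₊ : ℝ) ≤
      #((Icc 1 ⌊X⌋₊).filter (fun q : ℕ => q.Prime ∧ B < (q : ℝ))) + B + 1 := by
  classical
  have hsub : Nat.primesLE ⌊X⌋₊ ⊆
      (Icc 1 ⌊X⌋₊).filter (fun q : ℕ => q.Prime ∧ B < (q : ℝ)) ∪ range (⌊B⌋₊ + 1) := by
    intro p hp
    rw [Nat.primesLE_eq_filter_range, mem_filter, mem_range] at hp
    rcases lt_or_ge B (p : ℝ) with hBp | hpB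
    · exact mem_union_left _ (mem_filter.mpr ⟨mem_Icc.mpr ⟨hp.2.one_lt.le, by omega⟩, hp.2, hBp⟩)
    · exact mem_union_right _ (mem_range.mpr (Nat.lt_succ_of_le (Nat.le_floor hpB)))
  have hcard := (card_le_card hsub).trans (card_union_le _ _)
  rw [Nat.primesLE_card_eq_primeCounting, card_range] at hcard
  have hfl : ((⌊B⌋₊ : ℕ) : ℝ) ≤ B := Nat.floor_le hB
  calc (Nat.primeCounting ⌊X⌋₊ : ℝ)
      ≤ ((#((Icc 1 ⌊X⌋₊).filter (fun q : ℕ => q.Prime ∧ B < (q : ℝ))) + (⌊B⌋₊ + 1) : ℕ) : ℝ) := by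
        exact_mod_cast hcard
    _ ≤ _ := by push_cast; linarith

/-- The counting core of the range `θ > 1`: if `η > 1`, `c > 0` and `F(x, q) ≥ c` for all primes
`q ∈ (4x, x^η]` (and `F ≥ 0`), then `∑_{q ≤ x^η} F(x, q)` is not `O(x / log x)`, because there are
`≫ x^η / log x` such primes (Chebyshev). [folklore] -/
theorem not_isBigO_sum_Icc_floor_rpow {η c : ℝ} (hη : 1 < η) (hc : 0 < c) (F : ℝ → ℕ → ℝ)
    (hF0 : ∀ x q, 0 ≤ F x q)
    (hF : ∀ᶠ x : ℝ in atTop, ∀ q : ℕ, q.Prime → 4 * x < q → q ≤ ⌊x ^ η⌋₊ → c ≤ F x q) :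
    ¬ (fun x : ℝ => ∑ q ∈ Icc 1 ⌊x ^ η⌋₊, F x q) =O[atTop] fun x : ℝ => x / Real.log x ^ (1 : ℝ) := by
  intro h
  obtain ⟨C, hC⟩ := isBigO_iff.mp h
  set δ : ℝ := (η - 1) / 2 with hδdef
  have hδ : 0 < δ := by rw [hδdef]; linarith
  have hl2 : (1 / 4 : ℝ) < Real.log 2 - 1 / 4 := by linarith [Real.log_two_gt_d9]
  set K : ℝ := |C| * η / c with hKdef
  have hK0 : 0 ≤ K := by positivity
  set M : ℝ := (Real.log 8 + 5 * η / δ + K + 1) / (Real.log 2 - 1 / 4) with hMdef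
  have hl8 : 0 ≤ Real.log 8 := Real.log_nonneg (by norm_num)
  have hM1 : 1 ≤ M := by
    rw [hMdef, le_div_iff₀ (by linarith)]
    have : 0 ≤ 5 * η / δ := by positivity
    linarith [Real.log_two_lt_d9]
  have hev := (tendsto_rpow_atTop hδ).eventually_ge_atTop M
  obtain ⟨x, hCx, hFx, hux, hx3⟩ := (hC.and (hF.and (hev.and (eventually_ge_atTop (3 : ℝ))))).exists
  -- notation and basic facts at this `x`
  have hx1 : (1 : ℝ) ≤ x := by linarith
  have hx0 : (0 : ℝ) < x := by linarith
  have hL := one_le_log_of_three_le hx3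
  have hL0 : 0 < Real.log x := by linarith
  set u : ℝ := x ^ δ with hudef
  have hu1 : 1 ≤ u := hM1.trans hux
  set X : ℝ := x ^ η with hXdef
  have hXeq : X = x * u * u := by
    rw [hXdef, hudef, show η = 1 + δ + δ by rw [hδdef]; ring, Real.rpow_add hx0, Real.rpow_add hx0,
      Real.rpow_one]
  have hX1 : 1 < X := by
    have : (1 : ℝ) < x ^ (1 : ℝ) := by rw [Real.rpow_one]; linarith
    exact this.trans_le (Real.rpow_le_rpow_of_exponent_le hx1 hη.le)
  have hlogX : Real.log X = η * Real.log x := Real.log_rpow hx0 η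
  set Q : ℕ := ⌊X⌋₊ with hQdef
  set S := (Icc 1 Q).filter (fun q : ℕ => q.Prime ∧ 4 * x < (q : ℝ)) with hSdef
  -- (1) upper bound from the `O`-hypothesis
  have h1 : ∑ q ∈ Icc 1 Q, F x q ≤ |C| * (x / Real.log x) := by
    rw [Real.norm_eq_abs, abs_of_nonneg (sum_nonneg fun q _ => hF0 x q),
      norm_div_log_rpow (by linarith), Real.rpow_one] at hCx
    exact hCx.trans (mul_le_mul_of_nonneg_right (le_abs_self C) (div_pos hx0 hL0).le)
  -- (2) lower bound: `c · #S ≤ ∑`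
  have h2 : c * #S ≤ ∑ q ∈ Icc 1 Q, F x q := by
    calc c * #S = #S • c := by rw [nsmul_eq_mul, mul_comm]
      _ ≤ ∑ q ∈ S, F x q := card_nsmul_le_sum S (F x) c fun q hq => by
          rw [hSdef, mem_filter, mem_Icc] at hq
          exact hFx q hq.2.1 hq.2.2 hq.1.2
      _ ≤ ∑ q ∈ Icc 1 Q, F x q :=
          sum_le_sum_of_subset_of_nonneg (filter_subset _ _) fun q _ _ => hF0 x q
  -- (3) `π(Q) ≤ #S + 4x + 1` and (4) Chebyshev's lower bound for `π(Q)`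
  have h3 : (Nat.primeCounting Q : ℝ) ≤ #S + 4 * x + 1 :=
    primeCounting_floor_le_card_filter_add (by linarith)
  have h4 : ((X - 1) * Real.log 2 - Real.log (X + 2)) / Real.log X ≤ Nat.primeCounting Q :=
    Chebyshev.pi_ge' hX1
  -- (5) `log (X + 2) ≤ X/4 + log 4` and the final numerics
  have h5 : Real.log (X + 2) ≤ X / 4 + Real.log 4 := by
    have := Real.log_le_sub_one_of_pos (show 0 < (X + 2) / 4 by linarith)
    rw [Real.log_div (by linarith) (by norm_num)] at this
    linarith
  have h6 : Real.log x ≤ u / δ := by rw [hudef]; exact Real.log_le_rpow_div hx0.le hδ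
  have hlogX0 : 0 < Real.log X := by rw [hlogX]; positivity
  -- combine (1)–(4): `(X−1) log 2 − log(X+2) ≤ η log x (#S) ≤ η log x ((|C|/c) x/log x + 4x + 1)`
  have hS : (#S : ℝ) ≤ |C| / c * (x / Real.log x) := by
    rw [div_mul_eq_mul_div, le_div_iff₀ hc]; linarith
  have h7 : (X - 1) * Real.log 2 - Real.log (X + 2) ≤
      Real.log X * (|C| / c * (x / Real.log x) + 4 * x + 1) := by
    rw [div_le_iff₀ hlogX0] at h4
    nlinarith
  have h8 : Real.log X * (|C| / c * (x / Real.log x) + 4 * x + 1) =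
      K * x + η * Real.log x * (4 * x + 1) := by
    rw [hlogX, hKdef]; field_simp; ring
  have hlog8 : Real.log 2 + Real.log 4 = Real.log 8 := by
    rw [← Real.log_mul (by norm_num) (by norm_num)]; norm_num
  have hη0 : 0 < η := by linarith
  -- `X (log 2 − 1/4) ≤ log 8 + K x + η log x (4x+1) ≤ (log 8 + K + 5η/δ) · x u`
  have h9a : X * (Real.log 2 - 1 / 4) ≤ Real.log 8 + K * x + η * Real.log x * (4 * x + 1) := by
    linarith [h7, h8, h5, hlog8]
  have hxu1 : 1 ≤ x * u := by nlinarith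
  have hA : η * Real.log x * (4 * x + 1) ≤ 5 * η / δ * (x * u) := by
    have h45 : 4 * x + 1 ≤ 5 * x := by linarith
    calc η * Real.log x * (4 * x + 1) ≤ η * (u / δ) * (5 * x) := by gcongr
      _ = 5 * η / δ * (x * u) := by field_simp
  have hB : K * x ≤ K * (x * u) :=
    mul_le_mul_of_nonneg_left (le_mul_of_one_le_right hx0.le hu1) hK0
  have hC' : Real.log 8 ≤ Real.log 8 * (x * u) := le_mul_of_one_le_right hl8 hxu1
  have h9 : X * (Real.log 2 - 1 / 4) ≤ (Real.log 8 + K + 5 * η / δ) * (x * u) := by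
    linarith [h9a, hA, hB, hC']
  -- divide by `x u > 0`: `u (log 2 − 1/4) ≤ log 8 + K + 5η/δ`, contradicting `u ≥ M`
  have hxu : 0 < x * u := by positivity
  have h10 : u * (Real.log 2 - 1 / 4) ≤ Real.log 8 + K + 5 * η / δ := by
    have : (x * u) * (u * (Real.log 2 - 1 / 4)) ≤ (x * u) * (Real.log 8 + K + 5 * η / δ) := by
      calc (x * u) * (u * (Real.log 2 - 1 / 4)) = X * (Real.log 2 - 1 / 4) := by rw [hXeq]; ring
        _ ≤ _ := h9
        _ = _ := by ring
    exact le_of_mul_le_mul_left this hxu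
  have h11 : M * (Real.log 2 - 1 / 4) ≤ u * (Real.log 2 - 1 / 4) :=
    mul_le_mul_of_nonneg_right hux (by linarith)
  rw [hMdef, div_mul_cancel₀ _ (by linarith : (Real.log 2 - 1 / 4 : ℝ) ≠ 0)] at h11
  linarith

/-- For a prime `q > x` and `x ≥ 2`, `π(⌊x⌋; q, 2) = 1` (only the prime `2`). [folklore] -/
theorem primeCountingMod_two_of_lt {q : ℕ} {x : ℝ} (hx : 2 ≤ x) (hxq : x < q) :
    LevelOfDistribution.primeCountingMod q 2 ⌊x⌋₊ = 1 := by
  have hx0 : 0 ≤ x := by linarith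
  have h2q : 2 < q := by exact_mod_cast lt_of_le_of_lt hx hxq
  have hfl : 2 ≤ ⌊x⌋₊ := Nat.le_floor (by exact_mod_cast hx)
  rw [LevelOfDistribution.primeCountingMod, card_eq_one]
  refine ⟨2, ?_⟩
  ext p
  simp only [mem_filter, mem_range, mem_singleton]
  constructor
  · rintro ⟨hp, -, hmod⟩
    have hpq : p < q := by
      have : (p : ℝ) ≤ x := (Nat.cast_le.mpr (Nat.lt_succ_iff.mp hp)).trans (Nat.floor_le hx0)
      exact_mod_cast this.trans_lt hxq
    rw [Nat.ModEq, Nat.mod_eq_of_lt hpq, Nat.mod_eq_of_lt h2q] at hmod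
    exact hmod
  · rintro rfl
    exact ⟨by omega, Nat.prime_two, rfl⟩

/-- **`θ > 1`: the `ψ`-form fails** (`PrimesHaveLevel.le_one` of `LevelOfDistribution.lean`: for
`⌊x⌋ < q ≤ 2⌊x⌋` one has `ψ(x; q, 1) = 0`, so `E_ψ(x; q) ≥ 1/2`). [folklore] -/
theorem not_primesHaveLevel_of_one_lt {θ : ℝ} (hθ : 1 < θ) : ¬PrimesHaveLevel θ :=
  fun h => absurd h.le_one (not_le.mpr hθ)

/-- **`θ > 1`: the `π`-form fails.**  For primes `q ∈ (4x, x^{(1+θ)/2}]` and `a = 2`,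
`|π(x;q,2) − π(x)/φ(q)| ≥ 1 − 2/3 = 1/3`. [folklore] -/
theorem not_primesHaveLevelPi_of_one_lt {θ : ℝ} (hθ : 1 < θ) : ¬PrimesHaveLevelPi θ := by
  intro h
  have hε : 0 < (θ - 1) / 2 := by linarith
  have hη : 1 < θ - (θ - 1) / 2 := by linarith
  refine not_isBigO_sum_Icc_floor_rpow hη (by norm_num : (0 : ℝ) < 1 / 3)
    (fun x q => ⨆ y : Set.Icc 1 x, ⨆ a : (ZMod q)ˣ,
      |(LevelOfDistribution.primeCountingMod q (a : ZMod q).val ⌊(y : ℝ)⌋₊ : ℝ) -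
        (Nat.primeCounting ⌊(y : ℝ)⌋₊ : ℝ) / Nat.totient q|)
    (fun x q => Real.iSup_nonneg fun _ => Real.iSup_nonneg fun _ => abs_nonneg _) ?_
    (h 1 one_pos _ hε)
  filter_upwards [eventually_ge_atTop (2 : ℝ)] with x hx q hq h4x _
  have hx1 : (1 : ℝ) ≤ x := by linarith
  have hx0 : (0 : ℝ) ≤ x := by linarith
  have hxq : x < q := by linarith
  have h2q : 2 < q := by exact_mod_cast lt_of_le_of_lt hx hxq
  have hq2 : q ≠ 2 := by omega
  have hcop : Nat.Coprime 2 q := (Nat.coprime_primes Nat.prime_two hq).mpr (Ne.symm hq2)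
  haveI : NeZero q := ⟨hq.ne_zero⟩
  set u : (ZMod q)ˣ := ZMod.unitOfCoprime 2 hcop with hu
  have hle : |(LevelOfDistribution.primeCountingMod q (u : ZMod q).val ⌊x⌋₊ : ℝ) -
      (Nat.primeCounting ⌊x⌋₊ : ℝ) / Nat.totient q| ≤
      ⨆ y : Set.Icc 1 x, ⨆ a : (ZMod q)ˣ,
        |(LevelOfDistribution.primeCountingMod q (a : ZMod q).val ⌊(y : ℝ)⌋₊ : ℝ) -
          (Nat.primeCounting ⌊(y : ℝ)⌋₊ : ℝ) / Nat.totient q| := by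
    refine le_ciSup_of_le (bddAbove_range_primeCountingDisc x hq.ne_zero) ⟨x, hx1, le_rfl⟩ ?_
    exact le_ciSup (f := fun a : (ZMod q)ˣ =>
      |(LevelOfDistribution.primeCountingMod q (a : ZMod q).val ⌊x⌋₊ : ℝ) - (Nat.primeCounting ⌊x⌋₊ : ℝ) / Nat.totient q|)
      (Set.finite_range _).bddAbove u
  have hval : (u : ZMod q).val = 2 := by
    rw [hu, ZMod.coe_unitOfCoprime, ZMod.val_natCast, Nat.mod_eq_of_lt h2q]
  rw [hval, primeCountingMod_two_of_lt hx hxq, Nat.cast_one] at hle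
  refine le_trans ?_ hle
  -- `π(⌊x⌋)/(q − 1) ≤ (x + 1)/(3x) ≤ 2/3`
  have hπ : (Nat.primeCounting ⌊x⌋₊ : ℝ) ≤ x + 1 := by
    have h1 : Nat.primeCounting ⌊x⌋₊ ≤ ⌊x⌋₊ + 1 := by
      rw [← Nat.primesLE_card_eq_primeCounting, Nat.primesLE_eq_filter_range]
      exact (card_filter_le _ _).trans (card_range _).le
    have h2 : ((⌊x⌋₊ : ℕ) : ℝ) ≤ x := Nat.floor_le hx0
    calc (Nat.primeCounting ⌊x⌋₊ : ℝ) ≤ ((⌊x⌋₊ + 1 : ℕ) : ℝ) := by exact_mod_cast h1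
      _ ≤ x + 1 := by push_cast; linarith
  have hq1 : (3 : ℝ) * x ≤ (Nat.totient q : ℝ) := by
    rw [Nat.totient_prime hq, Nat.cast_sub hq.one_lt.le]; push_cast; linarith
  have hfrac : (Nat.primeCounting ⌊x⌋₊ : ℝ) / (Nat.totient q : ℝ) ≤ 2 / 3 := by
    rw [div_le_iff₀ (by linarith)]; linarith
  have hfrac0 : 0 ≤ (Nat.primeCounting ⌊x⌋₊ : ℝ) / (Nat.totient q : ℝ) := by positivity
  rw [le_abs]; left; linarith

/-- The equivalence of the two forms in the range `θ > 1`, where both are false. [folklore] -/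
theorem primesHaveLevel_iff_primesHaveLevelPi_of_one_lt {θ : ℝ} (hθ : 1 < θ) :
    PrimesHaveLevel θ ↔ PrimesHaveLevelPi θ :=
  iff_of_false (not_primesHaveLevel_of_one_lt hθ) (not_primesHaveLevelPi_of_one_lt hθ)

/-- In particular the Elliott–Halberstam range `θ < 1` in `ElliottHalberstam` cannot be extended past
`1`: `PrimesHaveLevel θ` fails for every `θ > 1` (the endpoint `θ = 1` is the
Friedlander–Granville theorem and is not treated here). [folklore] -/
theorem not_primesHaveLevel_two : ¬PrimesHaveLevel 2 :=
  not_primesHaveLevel_of_one_lt one_lt_two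

/-! ### Assembly -/

/-- **`π`-form ⇒ `ψ`-form for every `θ`**, given the prime number theorem with error
`O_A(x/(log x)^A)`: for `θ ≤ 1` this is `primesHaveLevel_of_isBigO`, and for `θ > 1` the hypothesis
`PrimesHaveLevelPi θ` is contradictory (`not_primesHaveLevelPi_of_one_lt`). [cite: CojocaruMurty2005, §9.2, proof of Thm. 9.2.1 (PDF p. 99)] -/
theorem PrimesHaveLevelPi.primesHaveLevel_of_isBigO' {θ : ℝ} (h : PrimesHaveLevelPi θ)
    (hPNT : ∀ A : ℝ, (fun x : ℝ => Chebyshev.psi x - x) =O[atTop] fun x : ℝ => x / Real.log x ^ A) :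
    PrimesHaveLevel θ := by
  by_cases hθ : θ ≤ 1
  · exact h.primesHaveLevel_of_isBigO hPNT hθ
  · exact absurd h (not_primesHaveLevelPi_of_one_lt (not_le.mp hθ))

/-- **The `ψ`- and `π`-forms of "the primes have level of distribution `x^θ`" are equivalent for
every `θ`**, given the prime number theorem with error `O_A(x/(log x)^A)` for every `A` (which the
`ψ`-form with any `θ > 0` itself contains, `PrimesHaveLevel.isBigO_chebyshevPsi_sub_self`, so that
this hypothesis cannot be dispensed with).  Ranges: `θ − ε < 0` vacuous; `0 < θ ≤ 1` by partial
summation, Chebyshev's `ψ − ϑ ≪ √x log x`, `∑_{q ≤ Q} 1/φ(q) ≪ log² Q` and the averaged prime-power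
count of `PrimePowersInProgressions.lean` (Cojocaru–Murty, proof of Thm 9.2.1; Iwaniec–Kowalski §17.1);
`θ > 1` both forms false. [cite: IwaniecKowalski2004, §17.1] -/
theorem primesHaveLevel_iff_primesHaveLevelPi_of_isBigO
    (hPNT : ∀ A : ℝ, (fun x : ℝ => Chebyshev.psi x - x) =O[atTop] fun x : ℝ => x / Real.log x ^ A) :
    primesHaveLevel_iff_primesHaveLevelPi :=
  fun _ => ⟨fun h => h.primesHaveLevelPi, fun h => h.primesHaveLevel_of_isBigO' hPNT⟩

/-- **Assembly of the named fact `primesHaveLevel_iff_primesHaveLevelPi` from its one remaining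
input**, the prime number theorem with de la Vallée Poussin's error term
(`ChebyshevPsiDeLaValleePoussin`, Montgomery–Vaughan Thm 6.9 (6.12), vendored in
`Literature/NumberTheory/LFunctions/PrimeNumberTheoremErrorTerm.lean`).  Once that fact is
discharged, `primesHaveLevel_iff_primesHaveLevelPi_holds` is this theorem applied to it. [cite: IwaniecKowalski2004, §17.1] -/
theorem primesHaveLevel_iff_primesHaveLevelPi_of (hPNT : LFunctions.ChebyshevPsiDeLaValleePoussin) :
    primesHaveLevel_iff_primesHaveLevelPi :=
  primesHaveLevel_iff_primesHaveLevelPi_of_isBigO hPNT.isBigO_logPow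

/-- Conversely, the hypothesis of `primesHaveLevel_iff_primesHaveLevelPi_of_isBigO` is implied by the
`ψ`-form of the Bombieri–Vinogradov theorem (indeed by `PrimesHaveLevel θ` for any `θ > 0`), so the
prime number theorem with error `O_A(x/(log x)^A)` is exactly the arithmetic content separating the
two forms. [folklore] -/
theorem BombieriVinogradovStatement.isBigO_chebyshevPsi_sub_self (h : BombieriVinogradovStatement)
    (A : ℝ) : (fun x : ℝ => Chebyshev.psi x - x) =O[atTop] fun x : ℝ => x / Real.log x ^ A :=
  (h (1 / 4) (by norm_num)).isBigO_chebyshevPsi_sub_self (by norm_num) A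

/-- **The named fact `primesHaveLevel_iff_primesHaveLevelPi`, PROVED**: for every real `θ`,
`PrimesHaveLevel θ ↔ PrimesHaveLevelPi θ` (the `ψ`-form and the `π`-form of "the primes have level
of distribution `x^θ`" agree; Iwaniec–Kowalski §17.1, and the remark "proving (9.27) is equivalent
to proving [the `ψ`-form]" in the proof of Cojocaru–Murty Thm 9.2.1).  It is
`primesHaveLevel_iff_primesHaveLevelPi_of_isBigO` applied to the prime number theorem with error
`O_A(x/(log x)^A)` proved in `Literature/NumberTheory/LFunctions/ChebyshevPsiLogPowerError.lean`
(`Literature.NumberTheory.LFunctions.PsiLogPower.chebyshevPsi_sub_self_isBigO_div_logPow`). [cite: IwaniecKowalski2004, §17.1] -/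
theorem primesHaveLevel_iff_primesHaveLevelPi_holds : primesHaveLevel_iff_primesHaveLevelPi :=
  primesHaveLevel_iff_primesHaveLevelPi_of_isBigO LFunctions.PsiLogPower.chebyshevPsi_sub_self_isBigO_div_logPow

end Literature.NumberTheory.Sieve
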